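import Mathlib
import Literature.MathematicalPhysics.QuantumFieldTheory.Balaban1983to89.B6LevelTower

/-!
# `Balaban1983to89.B6TowerSums` — the (2.61) ∕ (2.63) ROW SUMS ON THE (k+1)-LEVEL TOWER with ONE constant for EVERY
number of levels (the k-uniformity of c₁(α) that (2.68), (2.83), (2.88) consume, exercised for the first time on a
coordinatised geometry with ≥ 3 levels where (2.2) ∕ (2.60) have content), every geometry-side binder of the tree's
Proposition 2.3 engine discharged JOINTLY on it, and the TWO-SCALE PRESUPPOSITION of Sects. B–C (the cube objects □,
□̃, □̃², □̃³ = T_□ never reach two levels away, never both neighbouring levels — located objection G-B6-13) decided on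
the tower by explicit inequalities between R and L: downward ⟺ rL² < (a + 1)L + 1, both-neighbours ⟸ 2rL < (a + 1)L + 1
(r = the object's half-width in Λ_j-spacings, a + 1 = RM the level thickness), i.e. R ≥ ρL and R ≥ 2ρ for an object of
ρ big blocks half-width — with the three-level witnesses when they fail
(B6 = T. Bałaban, *Propagators and renormalization transformations for lattice gauge theories. II*, Commun. Math.
Phys. **96**, 223–250 (1984) [Balaban1984PropagatorsII]).

CITATION HEADER (lean-in-tree rule 2026-08-18).  Cell `pub-balaban`, unit `b2b-balaban-b06-g21` (paper sub-cell B06,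
gen 21 — the owner lineage of `…B6LevelTower` (gen 20), which this NEW LEAF imports and does not modify; it reuses BY
NAME the tower `TW`, `lvl`, `off` (`off_zero`, `off_succ`, `off_mono`, `off_gap`), `pos`, `bond`, `graph`,
`graph_connected`, `tdist`, `tposR`, `dist_tposR_eq`, `off_le_pos_zero`, `pos_zero_le`, `cornerA`, `dist_ge_levels`,
`twGeo`, `twGeo_hyps266`, `twGeo_isPseudoDist`, `twGeo_levelSep`, `twGeo_ineq260` of `…B6LevelTower`; the index
vocabulary `zv`, `zv_step`, `zv_mem_Icc` of `…B6CoverTwoLevel` (gen 18); `Profile` of `…B6DomainChange`;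
`Ineq261With`, `Ineq263With`, `ineq263With_of_261With` of `…B6Lemma21Repaired`; `Ineq260`, `Triangle254` of
`…B6RandomWalk`; `LevelSep` of `…B6Ineq268`; `IsPseudoDist` of `…B4Sect5Torus` — all imported through
`…B6LevelTower`).  Source: [B6] doi:10.1007/bf01240221, held `paper:balaban1984-cmp96-propagators-rt-ii`, journal
page = PDF page + 222; the quotations of pp. 224, 229, 230, 233, 234, 235, 237, 238 below were read from the page
renders `b2b-balaban-ref1/pages/1984-cmp96-propagators-rt-II/1984-cmp96-propagators-rt-II-p002, p007, p008, p011,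
p012, p013, p015, p016-x2.png` AS IMAGES this gen.  Cell rows: GAPS C-b06g21-1 (this module; cross-reference G-B6-13),
DIVERGENCE D-b06.41; census `HOME/b2b-balaban-b06-g20/CENSUS-B6-v1.6.md` (§2 rows (2.61) ∕ (2.63), hypothesis H-B6.5
"metric half: c₁ uniform in k on a ≥ 3-level model", §E gen-21 menu item (b)); journal claim TOWER-SUMS.

THE PRINTED TEXT.  [B6] p. 229 [PDF 7]: *"Each set Λ_j is a sum of big blocks of the size ML^jη(Λ_j ⊂ T^{(j)}_{L^jη}),
or of the size M if Λ_j is scaled to unit lattice. We cover B^j(Λ_j) by a sum of cubes □ of the size 2ML^jη, each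
cube being a sum of 2^d big blocks with a center y ∈ Λ_j (more exactly it belongs to the boundary of this set also).
Taking these covers for all j from 0 to k we get a family 𝒟 of cubes □ of different sizes and such that T_η =
⋃_{□∈𝒟} □."*; pp. 229–230 [PDF 7–8]: *"Let us assume that □ is a cube connected with a L^jη-scale (i.e. a cube of the
size 2ML^jη) and intersecting maybe the domain B^{j+1}(Λ_{j+1})."* … *"If □ ⊂ B^j(Λ_j), then the necessary properties
of G′(□) are described in Lemma 2.2 [3]. If □ intersects both domains B^j(Λ_j) and B^{j+1}(Λ_{j+1}), then we express
G′(□) in terms of operators introduced in the paper."*  p. 224 [PDF 2], (2.2): *"(L^jη)^{−1} dist(Ω^c_j, Ω_{j+1}) > RM,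
M is a size of big blocks and R is a big positive integer which will be fixed later."*  p. 233 [PDF 11]: *"Thus we have
to estimate the sum on the right-hand side above for one exponential factor. We use the inequality (2.48). From the
condition (2.2) and from the definition of the points y′_l, y_{l+1}, more exactly from the fact that they belong to
different surfaces Σ_j, we have (L^{j_{l,l+1}}η)^{−1}|y′_l − y_{l+1}| > RM. (2.57)"* and (2.58) *"Σ_{y′∈𝔅}
e^{−αδ₀d(y,y′)} = Σ_{j′=0}^k Σ_{y′∈Λ_{j′}} e^{−αδ₀d(y,y′)} ≤ Σ_{j′=0}^k Σ_{m=max{|j−j′|−1,0}}^∞ e^{−½αδ₀mRM} Σ_{z_l, z′_l,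
l=1,…,m, z_{m+1}∈Z^d} e^{−½αδ₀|s(y)−z₁|} e^{−½αδ₀|z₁−z′₁|}·…·e^{−½αδ₀|z′_m−z_{m+1}|} = Σ_{j′=0}^k Σ_{m=max{|j−j′|−1,0}}^∞
e^{−½αδ₀mRM}(c₀(1∕2α))^{d(2m+1)}, (2.58)"* … *"The summation over j′ gives finally the constant 12c₀^d(½α) = c₁(α)."*
p. 234 [PDF 12], Lemma 2.1: *"For the numbers α, 0 < α < 1, c₁(α) = 12c₀^d(½α), and RM satisfying (2.59) we have …
sup_{y∈𝔅} Σ_{y′∈𝔅} e^{−αδ₀d(y,y′)} ≤ c₁(α), (2.61) hence … and Σ_{y₁,…,y_{n−1}∈𝔅} e^{−δ₀d(y,y₁)}·…·e^{−δ₀d(y_{n−1},y′)}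
≤ c₁(α)^n e^{−(1−α)δ₀d(y,y′)}. (2.63)"*  p. 235 [PDF 13], after (2.68): *"where we have used the inequalities (2.60),
(2.63) of Lemma 1."* … *"It is easy to see from the bound (2.58) that Q′G′²Q′\* is a bounded operator on this space;
we have to use only the bound (2.61)."* … *"we take a second cube □̃ containing □ in the middle and of the size 4M and we
take an inverse of the operator (Q′G′(□̃)²Q′\*)↾_□ instead of (Q′G′²Q′\*)↾_□."* … *"At first let us find bounds on
C_□. We assume that either □̃ ⊂ B^j(Λ_j), or it intersects B^{j+1}(Λ_{j+1}) also."*  p. 237 [PDF 15], (2.83): *"=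
O(1)e^{−⅛δ₀M} L^{4(j−j′)} e^{−⅛δ₀RM max{|j−j′|−1,0}} e^{−δ₁d(y,y′)}(L^{j′}η)^{−d} ≤ O(1)e^{−⅛δ₀M} e^{−δ₁d(y,y′)}
(L^{j′}η)^{−d}, (2.83) where we have used the fact that y ∉ □′, and all the properties of the distance d(·, ·)."*
p. 238 [PDF 16]: *"Let us take a cube □ connected with a L^jη-scale, i.e. either □ ⊂ B^j(Λ_j), or it intersects also
B^{j+1}(Λ_{j+1}). A cube □̃ is obtained from □ by taking a sum of 4^d big blocks (of the size M when rescaled to the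
proper scale) with distance to □ equal to 0. In the same way a cube □̃² is formed, with □̃ instead of □ and built of
6^d big blocks, next a cube □̃³, and so on. We take the cube □̃³ and identify it with a torus, denoted by T_□"*.

THE POINT.  (1) In the tree (2.61) and (2.63) are BINDERS — `…B6Lemma21Repaired.Ineq261With c` ∕ `Ineq263With c` and
the profile `…B6DomainChange.Profile d id K` — of the Proposition 2.3 ∕ 2.7 engines (`…B6Prop23CubeDepth.
prop23_assembled_fine_twoLevel_cubes`: `hPr`, `hK`, `h261σ`, `h261`, `h263`, `hc`), and the printed c₁(α) itself is
typed as a bound that can FAIL (`…B6Lemma21Counterexample`); the binders had been discharged only on coordinatised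
models with at most TWO levels (`…B6CoverTwoLevel.tlGeo_profile` ∕ `tlGeo_ineq261With`, `…B6Lemma21TwoScale`), where
the sum over j′ in (2.58) has ≤ 2 terms — so the one thing (2.61) asserts about a k-level geometry, that sup_y Σ_{y′∈𝔅}
is bounded by a constant NOT DEPENDING ON THE NUMBER OF LEVELS (which (2.68), (2.83), (2.88) consume through their
sums over y″ ∈ 𝔅), had never been exercised on a model with ≥ 3 levels and a non-vacuous (2.2).  THIS MODULE proves it
on the level tower of `…B6LevelTower` (k + 1 levels, a box of (a+1)^d points of Λ_j per level, walls between
consecutive levels, d = the number of bonds of a shortest admissible contour): Σ_{y′} e^{−b·d(y,y′)} ≤ K_TW(b) for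
every y, every rate b > 0 and EVERY k, a, M, η, R, with K_TW(b) = 3K_near(b) + 2(d∕b)^d(1 − e^{−b})^{−1}, K_near(b) =
(d∕b)^d + (2(1 − e^{−b∕(dL³)})^{−1})^d — by the printed mechanism of (2.58): split 𝔅 over the levels j′; a level with
|j′ − j| = m + 2 ≥ 2 lies at d-distance ≥ (a + 1)(m + 1) (the tower's (2.57) ∕ (2.60), `dist_ge_levels`, a + 1 in
the place of RM) and contributes (a+1)^d e^{−b(a+1)(m+1)} ≤ (d∕b)^d e^{−bm} — two geometric tails; each of the ≤ 3
levels with |j′ − j| ≤ 1 contributes ≤ K_near(b) by a TWO-WAY bound on d: a shortest admissible contour from y to y′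
either visits a level ≥ max(j, j′) + 2 — then it has ≥ 2a + 4 bonds, by the WALL POTENTIAL Q = (a+1)·level + x₀,
which is 1-Lipschitz along bonds (the tower's form of paying (2.57) on the way up and on the way back) — or all its
bonds have extent ≤ L^{max+1} in the drawing, so d(y, y′) ≥ |pos y − pos y′|_∞ ∕ L^{max+1}; the second alternative is
summed as a product of d ONE-DIMENSIONAL lattice sums with REAL centres (Σ_{x∈T} e^{−γ|c − x|} ≤ 2(1 − e^{−γ})^{−1},
the role of c₀).  (2) The tree's Prop 2.3 engine takes its geometry through binders `hρ`, `hsep` (`LevelSep`, R > 0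
load-bearing), `h260`, `hK`∕`hPr`, `h261σ`, `h261`∕`h263`∕`hc`; `twGeo_prop23_geometry` discharges ALL of them at once
on the tower for every k (RM ≤ a + 1, L ≥ 1, rates 0 ≤ α′δ₀ < δ, σ > 0, δ₁ > 0), and `towerSums_largeness_nonvacuous`
adds the engine's two located largeness conditions `hsize` (L²e^{−α′δ₀RM} ≤ 1, the absorption of L^{2(j″−j)} in
(2.68)) and `hthr` (L⁴ ≤ e^{⅛((δ−α′δ₀)∕3)RM}, the absorption of L^{4(j−j′)} in (2.83)) on a three-level instance with
RM = a + 1 = 24, L = 2: «RM large against L» and (2.2) are compatible on ≥ 3 levels — jointly they only force the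
level thickness a + 1.  (3) The local analysis of Sects. B–C is TWO-scale ((2.41) on □, (2.70)ff on □̃, (2.89)ff on
T_□ = □̃³) and PRESUPPOSES that a cube object of 𝒟_j with its enlargements meets only B^{j−1}, B^j, B^{j+1} and never
both B^{j−1} and B^{j+1} (the dichotomy «□ ⊂ B^j(Λ_j), or it intersects also B^{j+1}(Λ_{j+1})» of pp. 230, 235,
238) — the cell's located objection G-B6-13 («R ≥ 4L», «R > 8»; (2.2) says «fixed later» and only (2.59) ever
constrains RM).  On the tower this module makes the presupposition KERNEL ARITHMETIC: reading a site in the index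
frame of level l (frame_l(y) = (pos y − off_l·e₀) ∕ L^l), a level-l object = {y : |frame_l(y)_μ − c_μ| ≤ r ∀μ} with
centre c in the level box and half-width r: it misses the levels ≥ l + 2 whenever r < (a + 1)L + 1 (always for the
printed objects), misses the levels ≤ l − 2 IFF rL² < (a + 1)L + 1 (`inReach_downward_iff`, witness: the far corner of
level 0 has level-2 frame −((a + 1)L + 1)∕L²), and never contains both a level-(l+1) and a level-(l−1) site when 2rL <
(a + 1)L + 1 (their x₀-frames are ≥ a + 1 + 1∕L apart; attained at c = 0 with r ≥ a + 1: `inReach_both_wall`).  With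
a + 1 = RM (the tower's (2.2), `…B6LevelTower.twCS_cond22_iff` ∕ `twGeo_levelSep`) and r = ρM these are R ≥ ρL and
R ≥ 2ρ (`two_scale_of_R`) — exactly G-B6-13's thresholds for T_□ (ρ = 4), in the sup metric of the core sample.

WHAT THIS MODULE PROVES (kernel-checked; no `sorry`, no axiom beyond Lean's three):
1. §1 the wall potential `qv` = (a+1)·lvl + x₀; `abs_qv_sub_le_of_bond` ∕ `_of_adj` (1-Lipschitz), `abs_qv_sub_le_length`
   (|Q u − Q v| ≤ bonds), `qv_excess_le_length` (through a site v: (Qv − Qs) + (Qv − Qy) ≤ bonds),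
   **`two_a_add_four_le_length`** (a contour visiting a level ≥ max + 2 has ≥ 2a + 4 bonds), `dist_tposR_le_length_mul`
   (confinement: levels ≤ N ⇒ displacement ≤ bonds·L^N), **`min_le_tdist`** (min{2a + 4, |Δpos|_∞ ∕ L^{max+1}} ≤ d).
2. §2 elementary sums: `pow_mul_exp_neg_le` (t^n e^{−bt} ≤ (n∕b)^n), `succ_pow_mul_exp_le`, `sum_pow_le_inv_one_sub`,
   **`sum_exp_neg_abs_sub_le`** (Σ_{x∈T⊂ℤ} e^{−γ|c − x|} ≤ 2(1 − e^{−γ})^{−1}, real centre), **`sum_box_exp_le`** (the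
   d-dimensional box, product form), `one_sub_exp_neg_pos`, `exp_neg_mul_min_le`.
3. §3 `Knear`, **`Ktw`** (the constant; `Knear_nonneg`, `Ktw_nonneg`), `pos_mk`, **`level_sum_near`** (|j′ − j| ≤ 1:
   ≤ K_near), **`level_sum_far`** (|j′ − j| = m + 2: ≤ (d∕b)^d e^{−bm}), **`sum_exp_neg_tdist_le`** (Σ_{y′∈𝔅} ≤ K_TW(b),
   every k).
4. §4 on `twGeo d k a m L η R` (L ≥ 1): **`twGeo_profile`** (`Profile d id K_TW` — binder `hPr`), **`twGeo_ineq261With`**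
   ((2.61) with K_TW(αδ₀), αδ₀ > 0), **`twGeo_ineq263With`** ((2.63), via (2.54) and `ineq263With_of_261With`),
   `ineq261With_uniform_in_k` (one constant for the towers of every height and box side), **`twGeo_prop23_geometry`**
   (RM ≤ a + 1: `hρ`, `hsep`, `h260`, `hK`, `hPr`, `h261σ`, `h261`, `h263`, `hc` of the Prop 2.3 engine, jointly).
5. §5 frames and objects: `frame`, `frame_self` (= own index on own level), `InReach` (centre c, half-width r, level l);
   `frame_zero_ge_of_two_above` (≥ (a+1)(1+L)), **`lvl_le_of_inReach`** (upward blindness, r < (a+1)L + 1, c₀ ≤ a);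
   `off_sub_pos_zero_ge`, `frame_zero_le_of_two_below` (≤ −((a+1)L+1)∕L²), **`le_lvl_of_inReach`** (downward, rL² <
   (a+1)L + 1, c₀ ≥ 0), **`inReach_two_scale`** (only levels l, l ± 1), **`inReach_wall2`** (the witness: (a+1)L + 1 ≤
   rL² ⇒ the level-2 object at c = 0 contains the far corner of level 0), **`inReach_downward_iff`** (k ≥ 2: SHARP);
   `frame_zero_ge_of_above` (≥ a + 1), `frame_zero_le_of_below` (≤ −1∕L), **`not_inReach_both`** (2rL < (a+1)L + 1 ⇒
   never both neighbours, any centre), **`inReach_both_wall`** (r ≥ a + 1 ⇒ both, at c = 0, k ≥ 2); `reach_thr_of_R`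
   (RM ≤ a+1 ∧ ρL ≤ R ⇒ ρML² < (a+1)L + 1), `both_thr_of_R` (RM ≤ a+1 ∧ 2ρ ≤ R ⇒ 2ρML < (a+1)L + 1),
   **`two_scale_of_R`** (R ≥ ρL ∧ R ≥ 2ρ ⇒ the two-scale structure of every level-l object of ρ-blocks half-width).
6. §6 `towerSums_nonvacuous` ((d,k,a,M,L,η,R) = (1,2,5,2,2,1,3): profile, (2.61), (2.63) with K_TW; r = 3 two-scale
   (rL² = 12 < 13), r = 4 = 2M reaches level 0 from level 2 (16 ≥ 13), r = 6 = a + 1 at c = 0 on level 1 meets levels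
   0, 1, 2), `exp_three_ge_sixteen`, `towerSums_largeness_nonvacuous` ((1,2,23,4,2,1,6), RM = 24 = a + 1, α′δ₀ = 1,
   δ = 4, σ = ½, δ₁ = 1: all of `twGeo_prop23_geometry` plus `hsize` and `hthr` (16 ≤ e³)).

TYPING ∕ DIVERGENCE (D-b06.41).  (a) THE CONSTANT.  K_TW depends on L (through the confinement rate b∕(dL³)); the
printed c₁(α) = 12c₀^d(½α) does not.  This is an artefact of the crude confinement alternative of `min_le_tdist`
(every bond of a contour at levels ≤ max + 1 is given the largest extent L^{max+1}, and the near levels j′ = j ± 1 are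
read in the coarser frame): the true row sum of the tower is bounded independently of L as well (wall feet sit on the
sublattice LΛ_j of the finer level, so d-balls grow polynomially, uniformly in L), but proving that needs a leg code
across ≥ 3 scales in the manner of `…B6CoverTwoLevel` §3 — not done here.  What the consumers need is untouched by
this: `hPr : Profile g.dist id K` and `Ineq261With c` take ANY K ∕ c, print's O(1) of (2.68) ∕ (2.83) ∕ (2.88) are
"depending on d and L only" downstream anyway ([B11] (162)), and the uniformity that (2.61) is consumed for — in k
(and a, M, η, R) — holds.  (b) NO (2.59) enters (2.61) on the tower: print needs ¼αδ₀RM > 2d log c₀(½α) + 1 to sum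
c₀^{2dm} against e^{−½αδ₀mRM} in (2.58) (2m + 1 free lattice sums per level gap); the core sample has ONE box per
level, whose (a+1)^d points are summed against the level cost directly ((a+1)^d e^{−b(a+1)(m+1)} ≤ (d∕b)^d e^{−bm}),
so (2.61) holds here for every b = αδ₀ > 0 with no largeness of RM — a feature of the model, not a claim about print
(whose Λ_{j′} are shells with L^{d(j−j′)}-many more points per unit of Λ_j-volume).  (c) CUBE OBJECTS.  Print's □ ∈ 𝒟_j
is a union of 2^d big blocks (side 2ML^jη) centred at y ∈ Λ_j, □̃ ⊃ □ "in the middle" of side 4M, □̃² of 6^d blocks,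
□̃³ = T_□ of 8^d blocks, in the torus T_η with the blocks' alignment; on the tower a level-l OBJECT is its FRAME BOX
{y : |frame_l(y)_μ − c_μ| ≤ r ∀μ} — centre c (level-l index coordinates; "centre in the level box" = 0 ≤ c₀ ≤ a is
where the hypotheses use it), half-width r in Λ_l-spacings (r = ρM, ρ = 1, 2, 3, 4 for □, □̃, □̃², T_□), the frame being
the tower's drawing (positions in Λ₀-units, `…B6LevelTower.pos`) re-read in level-l units ACROSS the walls — i.e.
sup-reach from the centre, G-B6-13's reading; tangential extent beyond the core sample, block alignment of centres and
the torus identification of T_□ are not modelled.  The thresholds proved: upward r < (a+1)L + 1 (c₀ ≤ a); downward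
rL² < (a+1)L + 1 (c₀ ≥ 0), SHARP over all levels l ≤ k and centres (k ≥ 2); both-neighbours 2rL < (a+1)L + 1
sufficient for every centre, and violated at c = 0 as soon as r ≥ a + 1 (the exact both-neighbours threshold depends
on the centre and lies in ((a+1)L + 1)∕(2L), a + 1]; not computed).  (d) a + 1 ↔ RM: in print Ω_j^{(j)} is a sum of
big blocks, so the level thickness is a multiple of M and R ∈ ℕ₊; on the tower a ∈ ℕ is free, R is real, M = m ∈ ℕ, and
only RM ≤ a + 1 (`twGeo_levelSep`, `twGeo_ineq260`, `two_scale_of_R`) or the displayed strict inequalities enter; the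
R-form corollaries therefore read «R ≥ ρL», «R ≥ 2ρ» as SUFFICIENT conditions given RM ≤ a + 1, and the necessity
statements are in the r-form (`inReach_downward_iff`, `inReach_both_wall`) (INFO-2 of XREAD C-A67-3 carried).  (e)
L ∈ ℕ with L ≥ 1 throughout (L = 1, equal spacings, is allowed and degenerate), the confinement drawing is `tposR L 1`
(η = 1; η > 0 rescales distances and frames alike), distances of the drawing in the sup metric of ℝ^d as in
`…B6LevelTower` ∕ `…B6LevelGapMetric`; the rate is written b (= αδ₀, or σ(δ − α′δ₀)∕3, or δ₁∕2 in the engine's slots).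
(f) `hsize` ∕ `hthr` are the engine's typed forms (`…B6Prop23TwoLevelInputs`) of the absorptions L^{2(j″−j)} against
e^{−⅙δ₀RM·max} in (2.68) and L^{4(j−j′)} against e^{−⅛δ₀RM·max} in (2.83), with that module's renaming of the rates;
§6 only shows them satisfiable together with RM ≤ a + 1 on three levels (16 ≤ e³ at L = 2, RM = 24).

HONEST SCOPE.  A MODELLING item — kernel bookkeeping at fixed lattice spacing on the finite (k+1)-level carrier of
`…B6LevelTower`: it certifies that the tree's (2.61) ∕ (2.63) ∕ profile binders are dischargeable with ONE explicit
constant for ALL numbers of levels on a realised multiscale geometry with ≥ 3 levels on which (2.2) and (2.60) say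
something, that every geometry-side binder of the Prop 2.3 engine holds there jointly (with the located largeness
conditions on an instance), and that the two-scale presupposition behind □, □̃, T_□ is decided there by explicit
inequalities in R, L, with witnesses of its failure.  It does NOT prove the printed L-free c₁(α) on the tower, does NOT
build the cover {h_□} ∕ (2.36) on the tower nor instantiate Propositions 2.3 ∕ 2.7 on it (their analytic binders —
the kernels X, X̃_i, C_i, G′, Q′ — stay hypotheses of `…B6Prop23KernelInput` ∕ `…B6Prop23TwoLevelInputs` ∕ `…B6Prop27Kernel`; the two-level
instantiation is `…B6CoverRealizes`), is NOT the shell geometry of (2.1)–(2.4) in a torus, NOT a continuum or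
ultraviolet-stability statement, and NOT progress on any Clay problem.
-/

namespace Literature.MathematicalPhysics.QuantumFieldTheory.Balaban1983to89.B6TowerSums

open Finset Real
open Literature.Probability.LatticeModels (zdGraph zdGraph_adj_iff)
open B6CoverTwoLevel (zv zv_step zv_mem_Icc)
open B6LevelTower
open B6DomainChange (Profile)
open B6Lemma21Repaired (Ineq261With Ineq263With ineq263With_of_261With)
open B6RandomWalk (Ineq260 Triangle254)
open B4Sect5Torus (IsPseudoDist)
open B6Ineq268 (LevelSep)

/-! ## §1  The wall potential Q = (a+1)·j + x₀ and the cost of climbing two levels -/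

section Potential

variable {d k a : ℕ} [NeZero d]

/-- The WALL POTENTIAL of a site y = (j, x): Q(y) := (a + 1)·j + x₀ — the number of x₀-steps from the near corner of
level 0 to y along the x₀-axis of the tower. [folklore] -/
def qv (y : TW d k a) : ℤ := ((a : ℤ) + 1) * (lvl y : ℤ) + zv y.2 0

/-- **Q is 1-Lipschitz along bonds**: an own-level Λ_j-bond moves x₀ by at most one; a wall bond (x₀ = a of level j to
x₀ = 0 of level j + 1) raises Q by exactly one. [cite: Balaban1984PropagatorsII, (2.46) p.231] -/
theorem abs_qv_sub_le_of_bond (L : ℕ) {y y' : TW d k a} (h : bond L y y') : |qv y - qv y'| ≤ 1 := by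
  rcases h with ⟨h1, h2⟩ | ⟨h1, h2, h3, -⟩
  · have hl : lvl y = lvl y' := congrArg Fin.val h1
    obtain ⟨μ, hμ, hstep⟩ := zv_step h2
    by_cases hμ0 : μ = 0
    · subst hμ0
      have : qv y - qv y' = zv y.2 0 - zv y'.2 0 := by simp only [qv, hl]; ring
      rw [this, hstep]
    · have h0 : zv y.2 0 = zv y'.2 0 := hμ 0 (fun h => hμ0 h.symm)
      have : qv y - qv y' = 0 := by simp only [qv, hl, h0]; ring
      rw [this]; simp
  · have hz : zv y.2 0 = (a : ℤ) := by simp [zv, h2]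
    have hz' : zv y'.2 0 = 0 := by simp [zv, h3]
    have : qv y - qv y' = -1 := by
      simp only [qv, h1, hz, hz']; push_cast; ring
    rw [this]; simp

/-- Q is 1-Lipschitz along the edges of the bond graph. [cite: Balaban1984PropagatorsII, (2.46) p.231] -/
theorem abs_qv_sub_le_of_adj {L : ℕ} {y y' : TW d k a} (h : (graph L).Adj y y') : |qv y - qv y'| ≤ 1 := by
  rw [graph, SimpleGraph.fromRel_adj] at h
  rcases h.2 with h' | h'
  · exact abs_qv_sub_le_of_bond L h'
  · rw [abs_sub_comm]; exact abs_qv_sub_le_of_bond L h'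

/-- **|Q(u) − Q(v)| ≤ the number of bonds of any admissible contour from u to v.** [cite: Balaban1984PropagatorsII, (2.46) p.231] -/
theorem abs_qv_sub_le_length {L : ℕ} {u v : TW d k a} (W : (graph L).Walk u v) : |qv u - qv v| ≤ (W.length : ℤ) := by
  induction W with
  | nil => simp
  | @cons u' v' w' h p ih =>
    rw [SimpleGraph.Walk.length_cons, Nat.cast_succ]
    calc |qv u' - qv w'| ≤ |qv u' - qv v'| + |qv v' - qv w'| := abs_sub_le _ _ _
      _ ≤ 1 + (p.length : ℤ) := add_le_add (abs_qv_sub_le_of_adj h) ih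
      _ = (p.length : ℤ) + 1 := add_comm _ _

/-- A contour from s to y THROUGH a site v has at least (Q(v) − Q(s)) + (Q(v) − Q(y)) bonds. [folklore] -/
theorem qv_excess_le_length {L : ℕ} {s y : TW d k a} (W : (graph L).Walk s y) {v : TW d k a} (hv : v ∈ W.support) :
    (qv v - qv s) + (qv v - qv y) ≤ (W.length : ℤ) := by
  classical
  have hlen : W.length = (W.takeUntil v hv).length + (W.dropUntil v hv).length := by
    conv_lhs => rw [← W.take_spec hv]
    rw [SimpleGraph.Walk.length_append]
  have h1 := abs_qv_sub_le_length (W.takeUntil v hv)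
  have h2 := abs_qv_sub_le_length (W.dropUntil v hv)
  rw [hlen, Nat.cast_add]
  linarith [neg_le_abs (qv s - qv v), le_abs_self (qv v - qv y)]

/-- **Climbing two levels costs 2a + 4 bonds**: an admissible contour from s to y visiting a site of level ≥
max(j(s), j(y)) + 2 has at least 2a + 4 bonds (it crosses the full Λ-thickness a + 1 of a level box twice, wall bonds
included) — the tower's form of (2.57) *"(L^{j_{l,l+1}}η)^{−1}|y′_l − y_{l+1}| > RM"* paid on the way up AND on the way
back. [cite: Balaban1984PropagatorsII, (2.57) p.233 + (2.2) p.224] -/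
theorem two_a_add_four_le_length {L : ℕ} {s y : TW d k a} (W : (graph L).Walk s y) {v : TW d k a}
    (hv : v ∈ W.support) (hl : max (lvl s) (lvl y) + 2 ≤ lvl v) : 2 * a + 4 ≤ W.length := by
  have h := qv_excess_le_length W hv
  have hs0 : zv s.2 0 ≤ (a : ℤ) := (zv_mem_Icc s.2).2 0
  have hy0 : zv y.2 0 ≤ (a : ℤ) := (zv_mem_Icc y.2).2 0
  have hv0 : (0 : ℤ) ≤ zv v.2 0 := (zv_mem_Icc v.2).1 0
  have hls : lvl s + 2 ≤ lvl v := le_trans (by have := le_max_left (lvl s) (lvl y); omega) hl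
  have hly : lvl y + 2 ≤ lvl v := le_trans (by have := le_max_right (lvl s) (lvl y); omega) hl
  have hls' : (lvl s : ℤ) + 2 ≤ lvl v := by exact_mod_cast hls
  have hly' : (lvl y : ℤ) + 2 ≤ lvl v := by exact_mod_cast hly
  have e1 : 0 ≤ ((a : ℤ) + 1) * ((lvl v : ℤ) - lvl s - 2) := mul_nonneg (by positivity) (by linarith)
  have e2 : 0 ≤ ((a : ℤ) + 1) * ((lvl v : ℤ) - lvl y - 2) := mul_nonneg (by positivity) (by linarith)
  have key : (2 * a + 4 : ℤ) ≤ W.length := by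
    unfold qv at h
    nlinarith
  exact_mod_cast key

/-- **Confinement**: an admissible contour all of whose sites have level ≤ N moves the position (in Λ₀-units, sup norm
of ℝ^d) by at most (number of bonds)·L^N — each of its bonds is a Λ_j-bond with j ≤ N, of extent L^j ≤ L^N (L ≥ 1).
[cite: Balaban1984PropagatorsII, (2.46) p.231 + (2.1) p.224] -/
theorem dist_tposR_le_length_mul {L : ℕ} (hL : 1 ≤ L) {N : ℕ} {u v : TW d k a} (W : (graph L).Walk u v)
    (hW : ∀ w ∈ W.support, lvl w ≤ N) :
    dist (tposR L 1 u) (tposR L 1 v) ≤ (W.length : ℝ) * (L : ℝ) ^ N := by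
  have hL' : (1 : ℝ) ≤ L := by exact_mod_cast hL
  induction W with
  | nil => simp
  | @cons u' v' w' h p ih =>
    have hu' : lvl u' ≤ N := hW u' (by simp)
    have hp : ∀ w ∈ p.support, lvl w ≤ N := fun w hw => hW w (by simp [hw])
    have hstep : dist (tposR L 1 u') (tposR L 1 v') ≤ (L : ℝ) ^ N := by
      rw [dist_tposR_eq zero_le_one h, mul_one]
      exact pow_le_pow_right₀ hL' ((min_le_left _ _).trans hu')
    rw [SimpleGraph.Walk.length_cons, Nat.cast_succ]
    calc dist (tposR L 1 u') (tposR L 1 w')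
        ≤ dist (tposR L 1 u') (tposR L 1 v') + dist (tposR L 1 v') (tposR L 1 w') := dist_triangle _ _ _
      _ ≤ (L : ℝ) ^ N + (p.length : ℝ) * (L : ℝ) ^ N := add_le_add hstep (ih hp)
      _ = ((p.length : ℝ) + 1) * (L : ℝ) ^ N := by ring

/-- **The two-way lower bound on d(s, y)** (L ≥ 1): d(s, y) ≥ min{2a + 4, |pos s − pos y|_∞ ∕ L^{max(j(s), j(y))+1}} —
a shortest admissible contour either climbs two levels above both end-points (≥ 2a + 4 bonds) or stays at levels
≤ max + 1, where each bond covers at most L^{max+1} units of Λ₀. [cite: Balaban1984PropagatorsII, (2.46)–(2.48) pp.231–232 + (2.57) p.233] -/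
theorem min_le_tdist {L : ℕ} (hL : 1 ≤ L) (s y : TW d k a) :
    min (2 * (a : ℝ) + 4) (dist (tposR L 1 s) (tposR L 1 y) / (L : ℝ) ^ (max (lvl s) (lvl y) + 1)) ≤ tdist L s y := by
  obtain ⟨W, hW⟩ := ((graph_connected (d := d) (k := k) (a := a) L).preconnected s y).exists_walk_length_eq_dist
  have htd : tdist L s y = (W.length : ℝ) := by unfold tdist; rw [← hW]
  rw [htd]
  by_cases hhi : ∃ v ∈ W.support, max (lvl s) (lvl y) + 2 ≤ lvl v
  · obtain ⟨v, hv, hlv⟩ := hhi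
    have := two_a_add_four_le_length W hv hlv
    refine (min_le_left _ _).trans ?_
    exact_mod_cast this
  · push Not at hhi
    have hL0 : (0 : ℝ) < L := by exact_mod_cast hL
    have hconf := dist_tposR_le_length_mul hL W (N := max (lvl s) (lvl y) + 1)
      (fun w hw => by have := hhi w hw; omega)
    refine (min_le_right _ _).trans ?_
    rw [div_le_iff₀ (by positivity)]
    exact hconf

end Potential

/-! ## §2  Elementary sums -/

section Elementary

/-- t^n e^{−bt} ≤ (n∕b)^n for t ≥ 0, b > 0, n ≥ 1 (from u ≤ e^u at u = bt∕n). [folklore] -/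
theorem pow_mul_exp_neg_le {n : ℕ} (hn : 0 < n) {b : ℝ} (hb : 0 < b) {t : ℝ} (ht : 0 ≤ t) :
    t ^ n * Real.exp (-(b * t)) ≤ ((n : ℝ) / b) ^ n := by
  have hn' : (0 : ℝ) < n := by exact_mod_cast hn
  have hn0 : (n : ℝ) ≠ 0 := hn'.ne'
  have hb0 : b ≠ 0 := hb.ne'
  have h1 : b * t / n ≤ Real.exp (b * t / n) := by
    have := Real.add_one_le_exp (b * t / n); linarith
  have h2 : t ≤ (n : ℝ) / b * Real.exp (b * t / n) := by
    calc t = (n : ℝ) / b * (b * t / n) := by field_simp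
      _ ≤ (n : ℝ) / b * Real.exp (b * t / n) := mul_le_mul_of_nonneg_left h1 (by positivity)
  have h3 : t ^ n ≤ ((n : ℝ) / b) ^ n * Real.exp (b * t) := by
    calc t ^ n ≤ ((n : ℝ) / b * Real.exp (b * t / n)) ^ n := pow_le_pow_left₀ ht h2 n
      _ = ((n : ℝ) / b) ^ n * Real.exp (b * t / n) ^ n := mul_pow _ _ _
      _ = ((n : ℝ) / b) ^ n * Real.exp (b * t) := by
          rw [← Real.exp_nat_mul]
          congr 2
          field_simp
  calc t ^ n * Real.exp (-(b * t)) ≤ ((n : ℝ) / b) ^ n * Real.exp (b * t) * Real.exp (-(b * t)) :=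
        mul_le_mul_of_nonneg_right h3 (Real.exp_nonneg _)
    _ = ((n : ℝ) / b) ^ n := by
        rw [mul_assoc, ← Real.exp_add, add_neg_cancel, Real.exp_zero, mul_one]

/-- (a+1)^n e^{−bX} ≤ (n∕b)^n whenever X ≥ a + 1 — the count of one level box against the cost of crossing a level.
[folklore] -/
theorem succ_pow_mul_exp_le {n : ℕ} (hn : 0 < n) {b : ℝ} (hb : 0 < b) (a : ℕ) {X : ℝ} (hX : (a : ℝ) + 1 ≤ X) :
    ((a : ℝ) + 1) ^ n * Real.exp (-(b * X)) ≤ ((n : ℝ) / b) ^ n :=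
  calc ((a : ℝ) + 1) ^ n * Real.exp (-(b * X)) ≤ ((a : ℝ) + 1) ^ n * Real.exp (-(b * ((a : ℝ) + 1))) :=
        mul_le_mul_of_nonneg_left (Real.exp_le_exp.2 (by nlinarith)) (by positivity)
    _ ≤ ((n : ℝ) / b) ^ n := pow_mul_exp_neg_le hn hb (by positivity)

/-- A finite geometric sum over any finite set of exponents is ≤ (1 − r)^{−1} (0 ≤ r < 1). [folklore] -/
theorem sum_pow_le_inv_one_sub {r : ℝ} (hr0 : 0 ≤ r) (hr1 : r < 1) (I : Finset ℕ) :
    ∑ i ∈ I, r ^ i ≤ (1 - r)⁻¹ := by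
  rw [← tsum_geometric_of_lt_one hr0 hr1]
  exact (summable_geometric_of_lt_one hr0 hr1).sum_le_tsum I (fun i _ => pow_nonneg hr0 i)

/-- **The one-dimensional lattice sum with a REAL centre**: Σ_{x ∈ T} e^{−γ|c − x|} ≤ 2(1 − e^{−γ})^{−1} for every
finite T ⊂ ℤ, c ∈ ℝ, γ > 0 (the integers on either side of c are at distances ≥ 0, 1, 2, … from it). [folklore] -/
theorem sum_exp_neg_abs_sub_le {γ : ℝ} (hγ : 0 < γ) (c : ℝ) (T : Finset ℤ) :
    ∑ x ∈ T, Real.exp (-(γ * |c - (x : ℝ)|)) ≤ 2 * (1 - Real.exp (-γ))⁻¹ := by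
  set r := Real.exp (-γ) with hr
  have hr0 : 0 ≤ r := (Real.exp_pos _).le
  have hr1 : r < 1 := by rw [hr, ← Real.exp_zero]; exact Real.exp_lt_exp.mpr (by linarith)
  have hpow : ∀ n : ℕ, Real.exp (-(γ * (n : ℝ))) = r ^ n := fun n => by
    rw [hr, ← Real.exp_nat_mul]; congr 1; ring
  set u := ⌊c⌋ with hu
  have hu1 : (u : ℝ) ≤ c := Int.floor_le c
  have hu2 : c < (u : ℝ) + 1 := Int.lt_floor_add_one c
  rw [← Finset.sum_filter_add_sum_filter_not T (fun x => x ≤ u)]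
  have hA : ∑ x ∈ T.filter (fun x => x ≤ u), Real.exp (-(γ * |c - (x : ℝ)|)) ≤ (1 - r)⁻¹ := by
    calc ∑ x ∈ T.filter (fun x => x ≤ u), Real.exp (-(γ * |c - (x : ℝ)|))
        ≤ ∑ x ∈ T.filter (fun x => x ≤ u), r ^ (u - x).toNat := by
          refine Finset.sum_le_sum fun x hx => ?_
          have hxu : x ≤ u := (Finset.mem_filter.mp hx).2
          rw [← hpow]
          apply Real.exp_le_exp.2
          have h1 : (((u - x).toNat : ℕ) : ℝ) = (u : ℝ) - x := by
            have : (((u - x).toNat : ℕ) : ℤ) = u - x := Int.toNat_of_nonneg (by omega)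
            exact_mod_cast this
          rw [h1]
          have hxr : (x : ℝ) ≤ u := by exact_mod_cast hxu
          have : (u : ℝ) - x ≤ |c - (x : ℝ)| := by
            rw [abs_of_nonneg (by linarith)]
            linarith
          nlinarith
      _ = ∑ i ∈ (T.filter (fun x => x ≤ u)).image (fun x => (u - x).toNat), r ^ i := by
          refine (Finset.sum_image fun x hx y hy hxy => ?_).symm
          have hx' : x ≤ u := (Finset.mem_filter.mp hx).2
          have hy' : y ≤ u := (Finset.mem_filter.mp hy).2
          have h := congrArg (fun n : ℕ => (n : ℤ)) hxy
          simp only [Int.toNat_of_nonneg (sub_nonneg.mpr hx'), Int.toNat_of_nonneg (sub_nonneg.mpr hy')] at h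
          linarith
      _ ≤ (1 - r)⁻¹ := sum_pow_le_inv_one_sub hr0 hr1 _
  have hB : ∑ x ∈ T.filter (fun x => ¬ x ≤ u), Real.exp (-(γ * |c - (x : ℝ)|)) ≤ (1 - r)⁻¹ := by
    calc ∑ x ∈ T.filter (fun x => ¬ x ≤ u), Real.exp (-(γ * |c - (x : ℝ)|))
        ≤ ∑ x ∈ T.filter (fun x => ¬ x ≤ u), r ^ (x - u - 1).toNat := by
          refine Finset.sum_le_sum fun x hx => ?_
          have hxu : u + 1 ≤ x := by have := (Finset.mem_filter.mp hx).2; omega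
          rw [← hpow]
          apply Real.exp_le_exp.2
          have h1 : (((x - u - 1).toNat : ℕ) : ℝ) = (x : ℝ) - u - 1 := by
            have : (((x - u - 1).toNat : ℕ) : ℤ) = x - u - 1 := Int.toNat_of_nonneg (by omega)
            exact_mod_cast this
          rw [h1]
          have hxr : (u : ℝ) + 1 ≤ x := by exact_mod_cast hxu
          have : (x : ℝ) - u - 1 ≤ |c - (x : ℝ)| := by
            rw [abs_of_nonpos (by linarith)]
            linarith
          nlinarith
      _ = ∑ i ∈ (T.filter (fun x => ¬ x ≤ u)).image (fun x => (x - u - 1).toNat), r ^ i := by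
          refine (Finset.sum_image fun x hx y hy hxy => ?_).symm
          have hx' : u + 1 ≤ x := by have := (Finset.mem_filter.mp hx).2; omega
          have hy' : u + 1 ≤ y := by have := (Finset.mem_filter.mp hy).2; omega
          have h := congrArg (fun n : ℕ => (n : ℤ)) hxy
          simp only [Int.toNat_of_nonneg (show 0 ≤ x - u - 1 by omega),
            Int.toNat_of_nonneg (show 0 ≤ y - u - 1 by omega)] at h
          linarith
      _ ≤ (1 - r)⁻¹ := sum_pow_le_inv_one_sub hr0 hr1 _
  calc _ ≤ (1 - r)⁻¹ + (1 - r)⁻¹ := add_le_add hA hB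
    _ = 2 * (1 - r)⁻¹ := by ring

/-- **The box sum**: Σ_{x ∈ {0,…,n}^d} Π_μ e^{−γ|c_μ − x_μ|} ≤ (2(1 − e^{−γ})^{−1})^d for any real centre c (product of d
one-dimensional sums). [folklore] -/
theorem sum_box_exp_le {d n : ℕ} {γ : ℝ} (hγ : 0 < γ) (c : Fin d → ℝ) :
    ∑ x : Fin d → Fin (n + 1), ∏ μ, Real.exp (-(γ * |c μ - ((x μ : ℕ) : ℝ)|)) ≤
      (2 * (1 - Real.exp (-γ))⁻¹) ^ d := by
  rw [← Fintype.piFinset_univ, ← Finset.prod_univ_sum (fun _ : Fin d => (Finset.univ : Finset (Fin (n + 1))))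
    (fun μ t => Real.exp (-(γ * |c μ - ((t : ℕ) : ℝ)|)))]
  calc ∏ μ, ∑ t : Fin (n + 1), Real.exp (-(γ * |c μ - ((t : ℕ) : ℝ)|))
      ≤ ∏ _μ : Fin d, (2 * (1 - Real.exp (-γ))⁻¹) := by
        refine Finset.prod_le_prod (fun _ _ => Finset.sum_nonneg fun _ _ => (Real.exp_pos _).le) fun μ _ => ?_
        have h := sum_exp_neg_abs_sub_le hγ (c μ) ((Finset.univ : Finset (Fin (n + 1))).image (fun t : Fin (n + 1) => ((t : ℕ) : ℤ)))
        rw [Finset.sum_image (fun x _ y _ hxy => Fin.ext (by exact_mod_cast hxy))] at h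
        simpa [Int.cast_natCast] using h
    _ = (2 * (1 - Real.exp (-γ))⁻¹) ^ d := by simp

/-- 1 − e^{−γ} > 0 for γ > 0. [folklore] -/
theorem one_sub_exp_neg_pos {γ : ℝ} (hγ : 0 < γ) : 0 < 1 - Real.exp (-γ) := by
  have : Real.exp (-γ) < 1 := by rw [← Real.exp_zero]; exact Real.exp_lt_exp.mpr (by linarith)
  linarith

/-- e^{−b·min{A,B}} ≤ e^{−bA} + e^{−bB}. [folklore] -/
theorem exp_neg_mul_min_le (b A B : ℝ) : Real.exp (-(b * min A B)) ≤ Real.exp (-(b * A)) + Real.exp (-(b * B)) := by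
  rcases min_choice A B with h | h <;> rw [h]
  · linarith [Real.exp_pos (-(b * B))]
  · linarith [Real.exp_pos (-(b * A))]

end Elementary

/-! ## §3  The (2.61) row sum on the tower, level by level, with a constant uniform in k and a -/

section Sums

variable {d k a : ℕ} [NeZero d]

/-- The constant of one NEAR level (|j − j(s)| ≤ 1): K_near(b) := (d∕b)^d + (2(1 − e^{−b∕(dL³)})^{−1})^d. [folklore] -/
noncomputable def Knear (d L : ℕ) (b : ℝ) : ℝ :=
  ((d : ℝ) / b) ^ d + (2 * (1 - Real.exp (-(b / (d * (L : ℝ) ^ 3))))⁻¹) ^ d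

/-- **The tower's (2.61) constant** K_TW(b) := 3K_near(b) + 2(d∕b)^d(1 − e^{−b})^{−1} — depends on d, L and the rate
b = αδ₀ only: UNIFORM in the number of levels k + 1, the box side a + 1, M, η and R. [cite: Balaban1984PropagatorsII, (2.61) p.234] -/
noncomputable def Ktw (d L : ℕ) (b : ℝ) : ℝ :=
  3 * Knear d L b + 2 * ((d : ℝ) / b) ^ d * (1 - Real.exp (-b))⁻¹

/-- K_near ≥ 0. [folklore] -/
theorem Knear_nonneg (d L : ℕ) {b : ℝ} (hb : 0 < b) (hd : 0 < d) : 0 ≤ Knear d L b := by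
  unfold Knear
  have h1 : 0 < 1 - Real.exp (-(b / (d * (L : ℝ) ^ 3))) ∨ (L : ℝ) = 0 := by
    by_cases hL : (L : ℝ) = 0
    · exact Or.inr hL
    · left
      have hd' : (0 : ℝ) < d := by exact_mod_cast hd
      have hL' : (0 : ℝ) < L := lt_of_le_of_ne (Nat.cast_nonneg L) (Ne.symm hL)
      exact one_sub_exp_neg_pos (by positivity)
  rcases h1 with h1 | h1
  · positivity
  · rw [h1]
    simp
    positivity

/-- K_TW ≥ 0. [folklore] -/
theorem Ktw_nonneg (d L : ℕ) {b : ℝ} (hb : 0 < b) (hd : 0 < d) : 0 ≤ Ktw d L b := by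
  unfold Ktw
  have h1 := Knear_nonneg d L hb hd
  have h2 := one_sub_exp_neg_pos hb
  positivity

/-- The position of the site (j, x) in Λ₀-units: (off_j·[μ = 0]) + L^j x_μ. [cite: Balaban1984PropagatorsII, (2.1)–(2.3) p.224] -/
theorem pos_mk (L : ℕ) (z : Fin (k + 1)) (x : Fin d → Fin (a + 1)) (μ : Fin d) :
    pos L ((z, x) : TW d k a) μ = (if μ = 0 then off L a z else 0) + (L : ℤ) ^ (z : ℕ) * ((x μ : ℕ) : ℤ) := rfl

/-- **A NEAR level sums to ≤ K_near** (L ≥ 1, b > 0): for |j − j(s)| ≤ 1, Σ_{y ∈ level j} e^{−b d(s,y)} ≤ K_near(b) —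
the (a+1)^d sites of the level either cost ≥ 2a + 4 each (total ≤ (d∕b)^d) or are confined, e^{−b d} ≤
Π_μ e^{−(b∕dL³)|c_μ − x_μ|} with c the position of s read in level-j coordinates (total ≤ (2(1 − e^{−b∕dL³})^{−1})^d).
[cite: Balaban1984PropagatorsII, (2.61) p.234] -/
theorem level_sum_near {L : ℕ} (hL : 1 ≤ L) {b : ℝ} (hb : 0 < b) (s : TW d k a) (z : Fin (k + 1))
    (hz1 : (z : ℕ) ≤ lvl s + 1) (hz2 : lvl s ≤ (z : ℕ) + 1) :
    ∑ x : Fin d → Fin (a + 1), Real.exp (-(b * tdist L s (z, x))) ≤ Knear d L b := by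
  have hd : 0 < d := Nat.pos_of_ne_zero (NeZero.ne d)
  have hd' : (0 : ℝ) < d := by exact_mod_cast hd
  have hd0 : (d : ℝ) ≠ 0 := hd'.ne'
  have hL' : (1 : ℝ) ≤ L := by exact_mod_cast hL
  have hLpos : (0 : ℝ) < L := by linarith
  have hL0 : (L : ℝ) ≠ 0 := hLpos.ne'
  set N := lvl s + 2 with hN
  set D : (Fin d → Fin (a + 1)) → ℝ := fun x => dist (tposR L 1 s) (tposR L 1 ((z, x) : TW d k a)) with hD
  -- pointwise two-way bound
  have hpt : ∀ x, Real.exp (-(b * tdist L s (z, x))) ≤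
      Real.exp (-(b * (2 * (a : ℝ) + 4))) + Real.exp (-(b * (D x / (L : ℝ) ^ N))) := by
    intro x
    have hmin := min_le_tdist hL s ((z, x) : TW d k a)
    have hlv : lvl ((z, x) : TW d k a) = (z : ℕ) := rfl
    have hmax : max (lvl s) (lvl ((z, x) : TW d k a)) + 1 ≤ N := by rw [hlv]; omega
    have hDn : 0 ≤ D x := dist_nonneg
    have h2 : D x / (L : ℝ) ^ N ≤ D x / (L : ℝ) ^ (max (lvl s) (lvl ((z, x) : TW d k a)) + 1) :=
      div_le_div_of_nonneg_left hDn (by positivity) (pow_le_pow_right₀ hL' hmax)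
    have h3 : min (2 * (a : ℝ) + 4) (D x / (L : ℝ) ^ N) ≤ tdist L s (z, x) :=
      le_trans (min_le_min le_rfl h2) hmin
    calc Real.exp (-(b * tdist L s (z, x))) ≤ Real.exp (-(b * min (2 * (a : ℝ) + 4) (D x / (L : ℝ) ^ N))) :=
          Real.exp_le_exp.2 (neg_le_neg (mul_le_mul_of_nonneg_left h3 hb.le))
      _ ≤ _ := exp_neg_mul_min_le b _ _
  -- the sites costing ≥ 2a + 4
  have hcard : (Finset.univ : Finset (Fin d → Fin (a + 1))).card = (a + 1) ^ d := by
    rw [Finset.card_univ, Fintype.card_fun, Fintype.card_fin, Fintype.card_fin]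
  have hfirst : ∑ _x : Fin d → Fin (a + 1), Real.exp (-(b * (2 * (a : ℝ) + 4))) ≤ ((d : ℝ) / b) ^ d := by
    rw [Finset.sum_const, hcard, nsmul_eq_mul]
    push_cast
    exact succ_pow_mul_exp_le hd hb a (by linarith)
  -- the confined sites
  have hsecond : ∑ x : Fin d → Fin (a + 1), Real.exp (-(b * (D x / (L : ℝ) ^ N))) ≤
      (2 * (1 - Real.exp (-(b / (d * (L : ℝ) ^ 3))))⁻¹) ^ d := by
    set γ := b / (d * (L : ℝ) ^ 3) with hγ
    have hγpos : 0 < γ := by positivity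
    have hLz : (0 : ℝ) < (L : ℝ) ^ (z : ℕ) := by positivity
    refine le_trans (Finset.sum_le_sum fun x _ => ?_)
      (sum_box_exp_le (n := a) hγpos
        (fun μ => (((pos L s μ - (if μ = 0 then off L a z else 0) : ℤ) : ℝ)) / (L : ℝ) ^ (z : ℕ)))
    -- coordinates of the drawing are bounded by the sup distance
    have hP : ∀ μ, |((pos L s μ : ℤ) : ℝ) - ((pos L ((z, x) : TW d k a) μ : ℤ) : ℝ)| ≤ D x := by
      intro μ
      have h := dist_le_pi_dist (tposR L 1 s) (tposR L 1 ((z, x) : TW d k a)) μ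
      rw [Real.dist_eq] at h
      simpa [tposR] using h
    -- … and equal L^j·|c_μ − x_μ| in level-j coordinates
    have habs : ∀ μ, (L : ℝ) ^ (z : ℕ) *
        |(((pos L s μ - (if μ = 0 then off L a z else 0) : ℤ) : ℝ)) / (L : ℝ) ^ (z : ℕ) - ((x μ : ℕ) : ℝ)| =
        |((pos L s μ : ℤ) : ℝ) - ((pos L ((z, x) : TW d k a) μ : ℤ) : ℝ)| := by
      intro μ
      rw [← abs_of_pos hLz, ← abs_mul, abs_of_pos hLz]
      congr 1
      rw [pos_mk L z x μ, mul_sub, mul_div_cancel₀ _ hLz.ne']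
      push_cast
      ring
    have key : ∑ μ : Fin d, γ * |(((pos L s μ - (if μ = 0 then off L a z else 0) : ℤ) : ℝ)) / (L : ℝ) ^ (z : ℕ) -
        ((x μ : ℕ) : ℝ)| ≤ b * (D x / (L : ℝ) ^ N) := by
      have h1 : ∀ μ, γ * |(((pos L s μ - (if μ = 0 then off L a z else 0) : ℤ) : ℝ)) / (L : ℝ) ^ (z : ℕ) -
          ((x μ : ℕ) : ℝ)| ≤ γ * (D x / (L : ℝ) ^ (z : ℕ)) := by
        intro μ
        refine mul_le_mul_of_nonneg_left ?_ hγpos.le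
        rw [le_div_iff₀ hLz, mul_comm, habs μ]
        exact hP μ
      calc ∑ μ : Fin d, γ * |(((pos L s μ - (if μ = 0 then off L a z else 0) : ℤ) : ℝ)) / (L : ℝ) ^ (z : ℕ) -
              ((x μ : ℕ) : ℝ)|
          ≤ ∑ _μ : Fin d, γ * (D x / (L : ℝ) ^ (z : ℕ)) := Finset.sum_le_sum fun μ _ => h1 μ
        _ = (d : ℝ) * (γ * (D x / (L : ℝ) ^ (z : ℕ))) := by
            rw [Finset.sum_const, Finset.card_univ, Fintype.card_fin, nsmul_eq_mul]
        _ = b * D x / (L : ℝ) ^ ((z : ℕ) + 3) := by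
            rw [hγ, pow_add]
            field_simp
        _ ≤ b * D x / (L : ℝ) ^ N :=
            div_le_div_of_nonneg_left (by positivity) (by positivity) (pow_le_pow_right₀ hL' (by omega))
        _ = b * (D x / (L : ℝ) ^ N) := by ring
    calc Real.exp (-(b * (D x / (L : ℝ) ^ N)))
        ≤ Real.exp (-(∑ μ : Fin d, γ * |(((pos L s μ - (if μ = 0 then off L a z else 0) : ℤ) : ℝ)) /
            (L : ℝ) ^ (z : ℕ) - ((x μ : ℕ) : ℝ)|)) := Real.exp_le_exp.2 (neg_le_neg key)
      _ = ∏ μ, Real.exp (-(γ * |(((pos L s μ - (if μ = 0 then off L a z else 0) : ℤ) : ℝ)) / (L : ℝ) ^ (z : ℕ) -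
            ((x μ : ℕ) : ℝ)|)) := by
          rw [← Finset.sum_neg_distrib, Real.exp_sum]
  calc ∑ x : Fin d → Fin (a + 1), Real.exp (-(b * tdist L s (z, x)))
      ≤ ∑ x : Fin d → Fin (a + 1), (Real.exp (-(b * (2 * (a : ℝ) + 4))) + Real.exp (-(b * (D x / (L : ℝ) ^ N)))) :=
        Finset.sum_le_sum fun x _ => hpt x
    _ = (∑ _x : Fin d → Fin (a + 1), Real.exp (-(b * (2 * (a : ℝ) + 4)))) +
          ∑ x : Fin d → Fin (a + 1), Real.exp (-(b * (D x / (L : ℝ) ^ N))) := Finset.sum_add_distrib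
    _ ≤ ((d : ℝ) / b) ^ d + (2 * (1 - Real.exp (-(b / (d * (L : ℝ) ^ 3))))⁻¹) ^ d := add_le_add hfirst hsecond
    _ = Knear d L b := rfl

/-- **A FAR level sums to ≤ (d∕b)^d e^{−bj}** (L ≥ 1, b > 0): for |j(z) − j(s)| = j + 2, every site of the level is at
distance ≥ (a + 1)(j + 1) from s (`dist_ge_levels` = (2.57) iterated), and (a+1)^d e^{−b(a+1)(j+1)} ≤ (d∕b)^d e^{−bj}.
[cite: Balaban1984PropagatorsII, (2.57)–(2.58) p.233 + (2.60) p.234] -/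
theorem level_sum_far {L : ℕ} (hL : 1 ≤ L) {b : ℝ} (hb : 0 < b) (s : TW d k a) (z : Fin (k + 1)) (j : ℕ)
    (hz : lvl s + 2 + j = (z : ℕ) ∨ (z : ℕ) + 2 + j = lvl s) :
    ∑ x : Fin d → Fin (a + 1), Real.exp (-(b * tdist L s (z, x))) ≤ ((d : ℝ) / b) ^ d * Real.exp (-b) ^ j := by
  have hd : 0 < d := Nat.pos_of_ne_zero (NeZero.ne d)
  have hgap : ∀ x, ((a : ℝ) + 1) * ((j : ℝ) + 1) ≤ tdist L s (z, x) := by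
    intro x
    have h := dist_ge_levels hL s ((z, x) : TW d k a)
    have hlv : (lvl ((z, x) : TW d k a) : ℝ) = ((z : ℕ) : ℝ) := rfl
    have hm : ((j : ℝ) + 1) ≤ max (|(lvl s : ℝ) - lvl ((z, x) : TW d k a)| - 1) 0 := by
      rw [hlv]
      refine le_trans ?_ (le_max_left _ _)
      rcases hz with h1 | h1
      · have : ((z : ℕ) : ℝ) = (lvl s : ℝ) + 2 + j := by exact_mod_cast h1.symm
        rw [this, abs_of_nonpos (by linarith)]; linarith
      · have : (lvl s : ℝ) = ((z : ℕ) : ℝ) + 2 + j := by exact_mod_cast h1.symm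
        rw [this, abs_of_nonneg (by linarith)]; linarith
    calc ((a : ℝ) + 1) * ((j : ℝ) + 1) ≤ ((a : ℝ) + 1) * max (|(lvl s : ℝ) - lvl ((z, x) : TW d k a)| - 1) 0 :=
          mul_le_mul_of_nonneg_left hm (by positivity)
      _ ≤ tdist L s (z, x) := h
  have hpt : ∀ x, Real.exp (-(b * tdist L s (z, x))) ≤ Real.exp (-(b * ((a : ℝ) + 1))) * Real.exp (-b) ^ j := by
    intro x
    rw [← Real.exp_nat_mul, ← Real.exp_add]
    apply Real.exp_le_exp.2
    have h1 : ((a : ℝ) + 1) * ((j : ℝ) + 1) = ((a : ℝ) + 1) + ((a : ℝ) + 1) * j := by ring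
    have h2 : (j : ℝ) ≤ ((a : ℝ) + 1) * j := by nlinarith [(Nat.cast_nonneg a : (0 : ℝ) ≤ a), (Nat.cast_nonneg j : (0 : ℝ) ≤ j)]
    have h3 : (a : ℝ) + 1 + j ≤ tdist L s (z, x) := by linarith [hgap x]
    have h4 := mul_le_mul_of_nonneg_left h3 hb.le
    linarith
  calc ∑ x : Fin d → Fin (a + 1), Real.exp (-(b * tdist L s (z, x)))
      ≤ ∑ _x : Fin d → Fin (a + 1), Real.exp (-(b * ((a : ℝ) + 1))) * Real.exp (-b) ^ j :=
        Finset.sum_le_sum fun x _ => hpt x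
    _ = ((a : ℝ) + 1) ^ d * Real.exp (-(b * ((a : ℝ) + 1))) * Real.exp (-b) ^ j := by
        rw [Finset.sum_const, Finset.card_univ, Fintype.card_fun, Fintype.card_fin, Fintype.card_fin, nsmul_eq_mul]
        push_cast; ring
    _ ≤ ((d : ℝ) / b) ^ d * Real.exp (-b) ^ j :=
        mul_le_mul_of_nonneg_right (succ_pow_mul_exp_le hd hb a le_rfl) (by positivity)

/-- **(2.61) ON THE TOWER, constant uniform in k**: Σ_{y ∈ 𝔅} e^{−b d(s,y)} ≤ K_TW(b) for every site s, every rate b > 0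
and every number of levels — the three near levels give ≤ 3K_near, the far levels above and below two geometric tails
≤ (d∕b)^d(1 − e^{−b})^{−1} each. [cite: Balaban1984PropagatorsII, (2.61) p.234 + (2.58) p.233] -/
theorem sum_exp_neg_tdist_le {L : ℕ} (hL : 1 ≤ L) {b : ℝ} (hb : 0 < b) (s : TW d k a) :
    ∑ y : TW d k a, Real.exp (-(b * tdist L s y)) ≤ Ktw d L b := by
  have hd : 0 < d := Nat.pos_of_ne_zero (NeZero.ne d)
  rw [Fintype.sum_prod_type]
  set G : Fin (k + 1) → ℝ := fun z => ∑ x : Fin d → Fin (a + 1), Real.exp (-(b * tdist L s (z, x))) with hG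
  set r := Real.exp (-b) with hr
  have hr0 : 0 ≤ r := (Real.exp_pos _).le
  have hr1 : r < 1 := by rw [hr, ← Real.exp_zero]; exact Real.exp_lt_exp.mpr (by linarith)
  set C := ((d : ℝ) / b) ^ d with hC
  have hC0 : 0 ≤ C := by positivity
  have hKn : 0 ≤ Knear d L b := Knear_nonneg d L hb hd
  set ls := lvl s with hls
  -- pointwise bound level by level
  set B : Fin (k + 1) → ℝ := fun z =>
    (if (z : ℕ) ≤ ls + 1 ∧ ls ≤ (z : ℕ) + 1 then Knear d L b else 0) +
    (if ls + 2 ≤ (z : ℕ) then C * r ^ ((z : ℕ) - (ls + 2)) else 0) +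
    (if (z : ℕ) + 2 ≤ ls then C * r ^ (ls - ((z : ℕ) + 2)) else 0) with hB
  have hGB : ∀ z, G z ≤ B z := by
    intro z
    rcases (show ((z : ℕ) ≤ ls + 1 ∧ ls ≤ (z : ℕ) + 1) ∨ ls + 2 ≤ (z : ℕ) ∨ (z : ℕ) + 2 ≤ ls by omega) with h1 | h2 | h3
    · have hn := level_sum_near hL hb s z h1.1 h1.2
      have h2 : ¬ (ls + 2 ≤ (z : ℕ)) := by omega
      have h3 : ¬ ((z : ℕ) + 2 ≤ ls) := by omega
      simp only [hB, if_pos h1, if_neg h2, if_neg h3, add_zero]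
      exact hn
    · have hf := level_sum_far hL hb s z ((z : ℕ) - (ls + 2)) (Or.inl (by omega))
      have h1 : ¬ ((z : ℕ) ≤ ls + 1 ∧ ls ≤ (z : ℕ) + 1) := by omega
      have h3 : ¬ ((z : ℕ) + 2 ≤ ls) := by omega
      simp only [hB, if_neg h1, if_pos h2, if_neg h3, zero_add, add_zero]
      exact hf
    · have hf := level_sum_far hL hb s z (ls - ((z : ℕ) + 2)) (Or.inr (by omega))
      have h1 : ¬ ((z : ℕ) ≤ ls + 1 ∧ ls ≤ (z : ℕ) + 1) := by omega
      have h2 : ¬ (ls + 2 ≤ (z : ℕ)) := by omega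
      simp only [hB, if_neg h1, if_neg h2, if_pos h3, zero_add]
      exact hf
  -- the three pieces
  have hnear : ∑ z : Fin (k + 1), (if (z : ℕ) ≤ ls + 1 ∧ ls ≤ (z : ℕ) + 1 then Knear d L b else 0) ≤
      3 * Knear d L b := by
    rw [← Finset.sum_filter, Finset.sum_const, nsmul_eq_mul]
    refine mul_le_mul_of_nonneg_right ?_ hKn
    have hc : ((Finset.univ : Finset (Fin (k + 1))).filter
        (fun z : Fin (k + 1) => (z : ℕ) ≤ ls + 1 ∧ ls ≤ (z : ℕ) + 1)).card ≤ 3 := by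
      calc ((Finset.univ : Finset (Fin (k + 1))).filter
            (fun z : Fin (k + 1) => (z : ℕ) ≤ ls + 1 ∧ ls ≤ (z : ℕ) + 1)).card
          ≤ (Finset.Icc (ls - 1) (ls + 1)).card := by
            refine Finset.card_le_card_of_injOn (fun z : Fin (k + 1) => (z : ℕ)) (fun z hz => ?_)
              (fun z _ w _ h => Fin.ext h)
            have h1 : (z : ℕ) ≤ ls + 1 ∧ ls ≤ (z : ℕ) + 1 := (Finset.mem_filter.mp (Finset.mem_coe.mp hz)).2
            simp only [Finset.mem_coe, Finset.mem_Icc]; omega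
        _ ≤ 3 := by rw [Nat.card_Icc]; omega
    exact_mod_cast hc
  have habove : ∑ z : Fin (k + 1), (if ls + 2 ≤ (z : ℕ) then C * r ^ ((z : ℕ) - (ls + 2)) else 0) ≤ C * (1 - r)⁻¹ := by
    rw [← Finset.sum_filter, ← Finset.mul_sum]
    refine mul_le_mul_of_nonneg_left ?_ hC0
    calc ∑ z ∈ (Finset.univ : Finset (Fin (k + 1))).filter (fun z : Fin (k + 1) => ls + 2 ≤ (z : ℕ)),
          r ^ ((z : ℕ) - (ls + 2))
        = ∑ i ∈ ((Finset.univ : Finset (Fin (k + 1))).filter (fun z : Fin (k + 1) => ls + 2 ≤ (z : ℕ))).image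
            (fun z : Fin (k + 1) => (z : ℕ) - (ls + 2)), r ^ i := by
          refine (Finset.sum_image fun x hx y hy hxy => ?_).symm
          have hx' : ls + 2 ≤ (x : ℕ) := (Finset.mem_filter.mp hx).2
          have hy' : ls + 2 ≤ (y : ℕ) := (Finset.mem_filter.mp hy).2
          have hxy' : (x : ℕ) - (ls + 2) = (y : ℕ) - (ls + 2) := hxy
          exact Fin.ext (by omega)
      _ ≤ (1 - r)⁻¹ := sum_pow_le_inv_one_sub hr0 hr1 _
  have hbelow : ∑ z : Fin (k + 1), (if (z : ℕ) + 2 ≤ ls then C * r ^ (ls - ((z : ℕ) + 2)) else 0) ≤ C * (1 - r)⁻¹ := by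
    rw [← Finset.sum_filter, ← Finset.mul_sum]
    refine mul_le_mul_of_nonneg_left ?_ hC0
    calc ∑ z ∈ (Finset.univ : Finset (Fin (k + 1))).filter (fun z : Fin (k + 1) => (z : ℕ) + 2 ≤ ls),
          r ^ (ls - ((z : ℕ) + 2))
        = ∑ i ∈ ((Finset.univ : Finset (Fin (k + 1))).filter (fun z : Fin (k + 1) => (z : ℕ) + 2 ≤ ls)).image
            (fun z : Fin (k + 1) => ls - ((z : ℕ) + 2)), r ^ i := by
          refine (Finset.sum_image fun x hx y hy hxy => ?_).symm
          have hx' : (x : ℕ) + 2 ≤ ls := (Finset.mem_filter.mp hx).2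
          have hy' : (y : ℕ) + 2 ≤ ls := (Finset.mem_filter.mp hy).2
          have hxy' : ls - ((x : ℕ) + 2) = ls - ((y : ℕ) + 2) := hxy
          exact Fin.ext (by omega)
      _ ≤ (1 - r)⁻¹ := sum_pow_le_inv_one_sub hr0 hr1 _
  calc ∑ z : Fin (k + 1), G z ≤ ∑ z : Fin (k + 1), B z := Finset.sum_le_sum fun z _ => hGB z
    _ = (∑ z : Fin (k + 1), (if (z : ℕ) ≤ ls + 1 ∧ ls ≤ (z : ℕ) + 1 then Knear d L b else 0)) +
        (∑ z : Fin (k + 1), (if ls + 2 ≤ (z : ℕ) then C * r ^ ((z : ℕ) - (ls + 2)) else 0)) +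
        ∑ z : Fin (k + 1), (if (z : ℕ) + 2 ≤ ls then C * r ^ (ls - ((z : ℕ) + 2)) else 0) := by
          rw [hB, Finset.sum_add_distrib, Finset.sum_add_distrib]
    _ ≤ 3 * Knear d L b + C * (1 - r)⁻¹ + C * (1 - r)⁻¹ := add_le_add (add_le_add hnear habove) hbelow
    _ = Ktw d L b := by rw [Ktw, hC, hr]; ring

end Sums

/-! ## §4  The binders `hPr`, `h261σ`, `h261`, `h263` on the (k+1)-level geometry `twGeo` -/

section Geo

variable (d : ℕ) [NeZero d] (k a m L : ℕ) (η R : ℝ)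

/-- **The (2.61)-profile of the tower (binder `hPr` of `…B6Prop23CubeDepth.prop23_assembled_fine_twoLevel_cubes`), for
every k**: `Profile d (id) K_TW`, L ≥ 1. [cite: Balaban1984PropagatorsII, (2.61) p.234] -/
theorem twGeo_profile (hL : 1 ≤ L) : Profile (twGeo d k a m L η R).dist (fun b => b) (Ktw d L) :=
  fun _ hb s => sum_exp_neg_tdist_le hL hb s

/-- **(2.61) with the constant K_TW(αδ₀) on the tower, every k** (the binders `h261σ`, `h261`): sup_y Σ_{y′∈𝔅}
e^{−αδ₀d(y,y′)} ≤ K_TW(αδ₀) for αδ₀ > 0, L ≥ 1. [cite: Balaban1984PropagatorsII, (2.61) p.234] -/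
theorem twGeo_ineq261With (hL : 1 ≤ L) {δ₀ α : ℝ} (h : 0 < α * δ₀) :
    Ineq261With (Ktw d L (α * δ₀)) (twGeo d k a m L η R) δ₀ α :=
  fun y => sum_exp_neg_tdist_le hL h y

/-- **(2.63) with the constant K_TW(αδ₀) on the tower, every k** (the binder `h263`), from (2.61) and (2.54) by
`…B6Lemma21Repaired.ineq263With_of_261With`. [cite: Balaban1984PropagatorsII, (2.63) p.234] -/
theorem twGeo_ineq263With (hL : 1 ≤ L) {δ₀ α : ℝ} (h : 0 < α * δ₀) (hδ : 0 ≤ δ₀) (hα : α ≤ 1) :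
    Ineq263With (Ktw d L (α * δ₀)) (twGeo d k a m L η R) δ₀ α :=
  ineq263With_of_261With (twGeo_hyps266 d k a m L η R).1 hδ hα (twGeo_ineq261With d k a m L η R hL h)

/-- **The printed c₁(α)-slot is k-UNIFORM on a (k+1)-level geometry**: one constant serves (2.61) on the towers of
EVERY height k and every box side a + 1 (d, L, αδ₀ fixed) — the uniformity in k that (2.68) ∕ (2.83) ∕ (2.88) consume.
[cite: Balaban1984PropagatorsII, Lemma 2.1 p.234] -/
theorem ineq261With_uniform_in_k (hL : 1 ≤ L) {δ₀ α : ℝ} (h : 0 < α * δ₀) :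
    ∀ k' a' : ℕ, Ineq261With (Ktw d L (α * δ₀)) (twGeo d k' a' m L η R) δ₀ α :=
  fun k' a' => twGeo_ineq261With d k' a' m L η R hL h

/-- **Every GEOMETRY-SIDE binder of the Proposition 2.3 engine `…B6Prop23CubeDepth.prop23_assembled_fine_twoLevel_cubes`
holds JOINTLY on the (k+1)-level tower, for every k** (L ≥ 1, RM ≤ a + 1, rates 0 ≤ α′δ₀ < δ, σ > 0, δ₁ > 0): `hρ`
(pseudo-distance), `hsep` (`LevelSep`, R > 0 load-bearing through RM ≤ a + 1), `h260` ((2.60)), `hK`∕`hPr` (the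
(2.61)-profile with K = K_TW), `h261σ` ((2.61) at rate σ(δ − α′δ₀)∕3), `h261`∕`h263` ((2.61)∕(2.63) at rate δ₁∕2, one
constant c = K_TW(δ₁∕2) ≥ 0 for both, `hc`).  The analytic binders (kernels X, X̃_i, C_i, G′, Q′, the cover {h_i}) are
not touched. [cite: Balaban1984PropagatorsII, Lemma 2.1 (2.60)–(2.63) p.234 + Proposition 2.3 p.238] -/
theorem twGeo_prop23_geometry (hL : 1 ≤ L) (hRM : R * m ≤ (a : ℝ) + 1) {δ₀ α' δ σ δ₁ : ℝ} (hα' : 0 ≤ α' * δ₀)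
    (hδ : α' * δ₀ < δ) (hσ : 0 < σ) (hδ₁ : 0 < δ₁) :
    IsPseudoDist (twGeo d k a m L η R).dist ∧ LevelSep (twGeo d k a m L η R) ∧
    Ineq260 (twGeo d k a m L η R) δ₀ α' ∧
    (∀ b : ℝ, 0 < b → 0 ≤ Ktw d L b) ∧ Profile (twGeo d k a m L η R).dist (fun y => y) (Ktw d L) ∧
    Ineq261With (Ktw d L (σ * ((δ - α' * δ₀) / 3))) (twGeo d k a m L η R) ((δ - α' * δ₀) / 3) σ ∧
    Ineq261With (Ktw d L (1 / 2 * δ₁)) (twGeo d k a m L η R) δ₁ (1 / 2) ∧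
    Ineq263With (Ktw d L (1 / 2 * δ₁)) (twGeo d k a m L η R) δ₁ (1 / 2) ∧
    0 ≤ Ktw d L (1 / 2 * δ₁) := by
  have hd : 0 < d := Nat.pos_of_ne_zero (NeZero.ne d)
  have h1 : 0 < σ * ((δ - α' * δ₀) / 3) := mul_pos hσ (by linarith)
  have h2 : (0 : ℝ) < 1 / 2 * δ₁ := by linarith
  exact ⟨twGeo_isPseudoDist d k a m L η R, twGeo_levelSep d k a m L η R hL hRM, twGeo_ineq260 d k a m L η R hL hRM hα',
    fun b hb => Ktw_nonneg d L hb hd, twGeo_profile d k a m L η R hL, twGeo_ineq261With d k a m L η R hL h1,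
    twGeo_ineq261With d k a m L η R hL h2, twGeo_ineq263With d k a m L η R hL h2 hδ₁.le (by norm_num),
    Ktw_nonneg d L h2 hd⟩

end Geo

/-! ## §5  Level frames and the printed cube objects on the tower: the thickness presupposition R ≳ L in the kernel -/

section Frames

variable {d k a : ℕ} [NeZero d]

/-- The LEVEL-l FRAME: the position of a site read in the index coordinates of level l — frame_l(y)_μ :=
(pos_μ(y) − off_l·[μ = 0]) ∕ L^l, so that the level-l box is {0, …, a}^d in its own frame. [cite: Balaban1984PropagatorsII, (2.1)–(2.3) p.224] -/
noncomputable def frame (L l : ℕ) (y : TW d k a) (μ : Fin d) : ℝ :=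
  (((pos L y μ - (if μ = 0 then off L a l else 0) : ℤ) : ℝ)) / (L : ℝ) ^ l

/-- A site of level l has frame_l = its own index x ∈ {0,…,a}^d (L ≥ 1). [folklore] -/
theorem frame_self {L : ℕ} (hL : 1 ≤ L) (y : TW d k a) (μ : Fin d) : frame L (lvl y) y μ = ((y.2 μ : ℕ) : ℝ) := by
  have hLpos : (0 : ℝ) < L := by exact_mod_cast hL
  unfold frame
  rw [div_eq_iff (by positivity)]
  simp only [pos, zv]
  push_cast
  ring

/-- **A PRINTED CUBE OBJECT of level l, read on the tower**: centre c (level-l index coordinates, a point of the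
level-l box) and half-width r in Λ_l-spacings — y lies in it iff |frame_l(y)_μ − c_μ| ≤ r for every μ.  The printed
objects: □ ∈ 𝒟_l *"of the size 2ML^jη"* (r = M), □̃ *"of the size 4M"* (r = 2M), □̃² (6^d blocks, r = 3M), T_□ = □̃³
(8^d blocks, r = 4M). [cite: Balaban1984PropagatorsII, p.229 (𝒟_j) + p.235 (□̃) + p.238 (□̃², □̃³ = T_□)] -/
def InReach (L : ℕ) (r : ℝ) (l : ℕ) (c : Fin d → ℝ) (y : TW d k a) : Prop := ∀ μ, |frame L l y μ - c μ| ≤ r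

/-- The x₀-frame of a site TWO OR MORE LEVELS ABOVE l is ≥ (a + 1)(1 + L) (the whole level-(l+1) block and the level-l
block lie in between). [cite: Balaban1984PropagatorsII, (2.2) p.224] -/
theorem frame_zero_ge_of_two_above {L : ℕ} (hL : 1 ≤ L) {y : TW d k a} {l : ℕ} (h : l + 2 ≤ lvl y) :
    ((a : ℝ) + 1) * (1 + L) ≤ frame L l y 0 := by
  have hLpos : (0 : ℝ) < L := by exact_mod_cast hL
  have h1 := off_le_pos_zero L y
  have h2 : off L a (l + 2) ≤ off L a (lvl y) := off_mono L a h
  have h3 : off L a (l + 2) = off L a l + ((a : ℤ) + 1) * (L : ℤ) ^ l + ((a : ℤ) + 1) * (L : ℤ) ^ (l + 1) := by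
    rw [off_succ, off_succ]
  have hz : ((a : ℤ) + 1) * (1 + L) * (L : ℤ) ^ l ≤ pos L y 0 - off L a l := by
    rw [pow_succ] at h3
    nlinarith
  unfold frame
  rw [if_pos rfl, le_div_iff₀ (by positivity)]
  exact_mod_cast hz

/-- **UPWARD BLINDNESS**: a level-l object of half-width r < (a + 1)L + 1 whose centre lies in the level-l box
(c₀ ≤ a) contains no site of level ≥ l + 2 — for the printed objects (r = ρM ≤ RM = a + 1 as soon as R ≥ ρ) always. [cite: Balaban1984PropagatorsII, p.230 («either □ ⊂ B^j(Λ_j) … or □ intersects both B^j(Λ_j) and B^{j+1}(Λ_{j+1})»)] -/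
theorem lvl_le_of_inReach {L : ℕ} (hL : 1 ≤ L) {r : ℝ} {l : ℕ} {c : Fin d → ℝ} {y : TW d k a} (hc : c 0 ≤ a)
    (hr : r < ((a : ℝ) + 1) * L + 1) (h : InReach L r l c y) : lvl y ≤ l + 1 := by
  by_contra hcon
  push Not at hcon
  have hf := frame_zero_ge_of_two_above hL (y := y) (l := l) (by omega)
  have h0 := h 0
  have := le_abs_self (frame L l y 0 - c 0)
  nlinarith

/-- The x₀-gap BELOW: a site two or more levels below n + 2 satisfies L^n((a + 1)L + 1) ≤ off_{n+2} − pos₀ (the whole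
level-(n+1) block plus the wall bond below it). [cite: Balaban1984PropagatorsII, (2.2) p.224 + (2.57) p.233] -/
theorem off_sub_pos_zero_ge (L : ℕ) {y : TW d k a} {n : ℕ} (h : lvl y ≤ n) :
    (L : ℤ) ^ n * (((a : ℤ) + 1) * L + 1) ≤ off L a (n + 2) - pos L y 0 := by
  have h1 := pos_zero_le L y
  have h2 := off_gap L a h
  rw [off_succ L a (n + 1), pow_succ]
  linarith

/-- The x₀-frame of a site TWO OR MORE LEVELS BELOW l is ≤ −((a + 1)L + 1) ∕ L² (L ≥ 1). [cite: Balaban1984PropagatorsII, (2.2) p.224] -/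
theorem frame_zero_le_of_two_below {L : ℕ} (hL : 1 ≤ L) {y : TW d k a} {l : ℕ} (h : lvl y + 2 ≤ l) :
    frame L l y 0 ≤ -((((a : ℝ) + 1) * L + 1) / (L : ℝ) ^ 2) := by
  obtain ⟨n, rfl⟩ : ∃ n, l = n + 2 := ⟨l - 2, by omega⟩
  have hLpos : (0 : ℝ) < L := by exact_mod_cast hL
  have hL0 : (L : ℝ) ≠ 0 := hLpos.ne'
  have hz := off_sub_pos_zero_ge L (y := y) (n := n) (by omega)
  have hr : (L : ℝ) ^ n * (((a : ℝ) + 1) * L + 1) ≤ ((off L a (n + 2) : ℤ) : ℝ) - ((pos L y 0 : ℤ) : ℝ) := by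
    exact_mod_cast hz
  unfold frame
  rw [if_pos rfl, div_le_iff₀ (by positivity)]
  have h3 : -((((a : ℝ) + 1) * L + 1) / (L : ℝ) ^ 2) * (L : ℝ) ^ (n + 2) = -((L : ℝ) ^ n * (((a : ℝ) + 1) * L + 1)) := by
    rw [pow_add]; field_simp
  rw [h3]
  push_cast
  linarith

/-- **DOWNWARD THRESHOLD (sufficiency)**: a level-l object of half-width r with rL² < (a + 1)L + 1 whose centre lies in
the level-l box (0 ≤ c₀) contains no site of level ≤ l − 2.  With a + 1 = RM and r = ρM (ρ = 1, 2, 3, 4 for □, □̃, □̃²,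
T_□) this is the condition **R ≥ ρL** (R ≥ 4L for T_□) on the R of (2.2) that the print never states.
[cite: Balaban1984PropagatorsII, (2.2) p.224 + p.235 («We assume that either □̃ ⊂ B^j(Λ_j), or it intersects B^{j+1}(Λ_{j+1}) also») + p.238] -/
theorem le_lvl_of_inReach {L : ℕ} (hL : 1 ≤ L) {r : ℝ} {l : ℕ} {c : Fin d → ℝ} {y : TW d k a} (hc : 0 ≤ c 0)
    (hr : r * (L : ℝ) ^ 2 < ((a : ℝ) + 1) * L + 1) (h : InReach L r l c y) : l ≤ lvl y + 1 := by
  by_contra hcon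
  push Not at hcon
  have hLpos : (0 : ℝ) < L := by exact_mod_cast hL
  have hf := frame_zero_le_of_two_below hL (y := y) (l := l) (by omega)
  have h0 := h 0
  have hr' : r < (((a : ℝ) + 1) * L + 1) / (L : ℝ) ^ 2 := by rw [lt_div_iff₀ (by positivity)]; exact hr
  have h1 : c 0 - frame L l y 0 ≤ r := by rw [abs_sub_comm] at h0; exact (le_abs_self _).trans h0
  linarith

/-- **THE TWO-SCALE STRUCTURE** of a printed cube object: under rL² < (a + 1)L + 1 (L ≥ 1, centre in the level box)
every site of a level-l object of half-width r has level l − 1, l or l + 1. [cite: Balaban1984PropagatorsII, p.230 + p.235 + p.238 («a cube □ connected with a L^jη-scale, i.e. either □ ⊂ B^j(Λ_j), or it intersects also B^{j+1}(Λ_{j+1})»)] -/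
theorem inReach_two_scale {L : ℕ} (hL : 1 ≤ L) {r : ℝ} {l : ℕ} {c : Fin d → ℝ} {y : TW d k a} (hc0 : 0 ≤ c 0)
    (hca : c 0 ≤ a) (hr : r * (L : ℝ) ^ 2 < ((a : ℝ) + 1) * L + 1) (h : InReach L r l c y) :
    lvl y ≤ l + 1 ∧ l ≤ lvl y + 1 := by
  have hLpos : (0 : ℝ) < L := by exact_mod_cast hL
  have hL' : (1 : ℝ) ≤ L := by exact_mod_cast hL
  refine ⟨lvl_le_of_inReach hL hca ?_ h, le_lvl_of_inReach hL hc0 hr h⟩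
  -- r < (a+1)L + 1: trivial if r ≤ 0, else r ≤ rL² < (a+1)L + 1
  by_cases hr0 : r ≤ 0
  · have : (0 : ℝ) < ((a : ℝ) + 1) * L + 1 := by positivity
    linarith
  · push Not at hr0
    have : r ≤ r * (L : ℝ) ^ 2 := by
      have h1 : (1 : ℝ) ≤ (L : ℝ) ^ 2 := one_le_pow₀ hL'
      nlinarith
    linarith

/-- **DOWNWARD THRESHOLD (necessity): the three-level witness.**  If (a + 1)L + 1 ≤ rL² (L ≥ 1) the level-2 frame
object of half-width r centred at the near corner c = 0 of the level-2 box CONTAINS the far corner of level 0 — two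
levels down: its x₀-frame is exactly −((a + 1)L + 1)∕L² (pure arithmetic of the frames; level 2 is a level of the
tower when k ≥ 2, `inReach_downward_iff`). [cite: Balaban1984PropagatorsII, (2.2) p.224 + p.238] -/
theorem inReach_wall2 {L : ℕ} (hL : 1 ≤ L) {r : ℝ} (hr : ((a : ℝ) + 1) * L + 1 ≤ r * (L : ℝ) ^ 2) :
    InReach L r 2 (fun _ => 0) ((⟨0, Nat.succ_pos k⟩, cornerA d a) : TW d k a) := by
  have hLpos : (0 : ℝ) < L := by exact_mod_cast hL
  have hr0 : 0 ≤ r := by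
    by_contra hneg
    push Not at hneg
    have h1 : r * (L : ℝ) ^ 2 < 0 := mul_neg_of_neg_of_pos hneg (by positivity)
    have h2 : (0 : ℝ) < ((a : ℝ) + 1) * L + 1 := by positivity
    linarith
  intro μ
  unfold frame
  by_cases hμ : μ = 0
  · subst hμ
    have h0 : pos L ((⟨0, Nat.succ_pos k⟩, cornerA d a) : TW d k a) 0 = (a : ℤ) := by
      simp [pos, lvl, off_zero, zv, cornerA]
    have h2 : off L a 2 = ((a : ℤ) + 1) + ((a : ℤ) + 1) * (L : ℤ) := by
      simp [off_succ, off_zero]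
    rw [if_pos rfl, h0, h2, sub_zero]
    have : ((((a : ℤ) - (((a : ℤ) + 1) + ((a : ℤ) + 1) * (L : ℤ))) : ℤ) : ℝ) / (L : ℝ) ^ 2 =
        -((((a : ℝ) + 1) * L + 1) / (L : ℝ) ^ 2) := by
      push_cast; ring
    rw [this, abs_neg, abs_of_nonneg (by positivity), div_le_iff₀ (by positivity)]
    exact hr
  · have h0 : pos L ((⟨0, Nat.succ_pos k⟩, cornerA d a) : TW d k a) μ = 0 := by
      simp [pos, lvl, zv, cornerA, hμ]
    rw [if_neg hμ, h0]
    simpa using hr0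

/-- **DOWNWARD THRESHOLD, SHARP**: (every object of half-width r on every level l ≤ k, centred in its box, misses the
levels ≤ l − 2) ⟺ rL² < (a + 1)L + 1 (k ≥ 2, L ≥ 1).  With a + 1 = RM: ⟺ R > ρL − 1∕(ML) for r = ρM, i.e. R ≥ ρL for
the printed integers. [cite: Balaban1984PropagatorsII, (2.2) p.224 («R is a big positive integer which will be fixed later») + p.238] -/
theorem inReach_downward_iff (hk : 2 ≤ k) {L : ℕ} (hL : 1 ≤ L) {r : ℝ} :
    (∀ l ≤ k, ∀ (c : Fin d → ℝ) (y : TW d k a), 0 ≤ c 0 → InReach L r l c y → l ≤ lvl y + 1) ↔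
      r * (L : ℝ) ^ 2 < ((a : ℝ) + 1) * L + 1 := by
  constructor
  · intro h
    by_contra hc
    push Not at hc
    have := h 2 hk (fun _ => 0) _ le_rfl (inReach_wall2 hL hc)
    simp [lvl] at this
  · intro hr l _ c y hc h
    exact le_lvl_of_inReach hL hc hr h

/-- The x₀-frame of a site ONE LEVEL ABOVE l is ≥ a + 1. [cite: Balaban1984PropagatorsII, (2.2) p.224] -/
theorem frame_zero_ge_of_above {L : ℕ} (hL : 1 ≤ L) {y : TW d k a} {l : ℕ} (h : lvl y = l + 1) :
    (a : ℝ) + 1 ≤ frame L l y 0 := by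
  have hLpos : (0 : ℝ) < L := by exact_mod_cast hL
  have h1 := off_le_pos_zero L y
  rw [h, off_succ] at h1
  have hz : ((a : ℤ) + 1) * (L : ℤ) ^ l ≤ pos L y 0 - off L a l := by linarith
  unfold frame
  rw [if_pos rfl, le_div_iff₀ (by positivity)]
  exact_mod_cast hz

/-- The x₀-frame of a site ONE LEVEL BELOW l is ≤ −1∕L (its far face is one wall bond below off_l). [cite: Balaban1984PropagatorsII, (2.2) p.224] -/
theorem frame_zero_le_of_below {L : ℕ} (hL : 1 ≤ L) {y : TW d k a} {l : ℕ} (h : lvl y + 1 = l) :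
    frame L l y 0 ≤ -(1 / (L : ℝ)) := by
  subst h
  have hLpos : (0 : ℝ) < L := by exact_mod_cast hL
  have hL0 : (L : ℝ) ≠ 0 := hLpos.ne'
  have h1 := pos_zero_le L y
  have h2 := off_succ L a (lvl y)
  have hz : pos L y 0 - off L a (lvl y + 1) ≤ -((L : ℤ) ^ lvl y) := by rw [h2]; linarith
  have hr : ((pos L y 0 : ℤ) : ℝ) - ((off L a (lvl y + 1) : ℤ) : ℝ) ≤ -((L : ℝ) ^ lvl y) := by exact_mod_cast hz
  unfold frame
  rw [if_pos rfl, div_le_iff₀ (by positivity)]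
  have h3 : -(1 / (L : ℝ)) * (L : ℝ) ^ (lvl y + 1) = -((L : ℝ) ^ lvl y) := by rw [pow_succ]; field_simp
  rw [h3]
  push_cast
  linarith

/-- **NOT BOTH NEIGHBOURS**: if 2rL < (a + 1)L + 1 (L ≥ 1), no level-l object of half-width r — whatever its centre —
contains both a site of level l + 1 and a site of level l − 1 (their x₀-frames are ≥ a + 1 + 1∕L apart).  With
a + 1 = RM, r = ρM: the condition **R ≥ 2ρ** (R ≥ 8 for T_□). [cite: Balaban1984PropagatorsII, p.230 + p.235 + p.238 (the dichotomy «□ ⊂ B^j(Λ_j), or it intersects also B^{j+1}(Λ_{j+1})»)] -/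
theorem not_inReach_both {L : ℕ} (hL : 1 ≤ L) {r : ℝ} (hr : 2 * r * L < ((a : ℝ) + 1) * L + 1) {l : ℕ}
    {c : Fin d → ℝ} {y y' : TW d k a} (hy : lvl y = l + 1) (hy' : lvl y' + 1 = l) :
    ¬ (InReach L r l c y ∧ InReach L r l c y') := by
  rintro ⟨h, h'⟩
  have hLpos : (0 : ℝ) < L := by exact_mod_cast hL
  have hL0 : (L : ℝ) ≠ 0 := hLpos.ne'
  have h1 := frame_zero_ge_of_above hL hy
  have h2 := frame_zero_le_of_below hL hy'
  have h3 := h 0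
  have h4 := h' 0
  have h5 : frame L l y 0 - c 0 ≤ r := (le_abs_self _).trans h3
  have h6 : c 0 - frame L l y' 0 ≤ r := by rw [abs_sub_comm] at h4; exact (le_abs_self _).trans h4
  have h7 : (a : ℝ) + 1 + 1 / L ≤ 2 * r := by linarith
  have h8 : ((a : ℝ) + 1 + 1 / L) * L ≤ 2 * r * L := mul_le_mul_of_nonneg_right h7 hLpos.le
  have h9 : ((a : ℝ) + 1 + 1 / L) * L = ((a : ℝ) + 1) * L + 1 := by field_simp
  linarith

/-- **BOTH NEIGHBOURS — the witness**: if r ≥ a + 1 (k ≥ 2, L ≥ 1) the level-1 object of half-width r centred at the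
near corner of the level-1 box contains the near corner of level 2 AND the far corner of level 0: three consecutive
levels in one object. [cite: Balaban1984PropagatorsII, p.238] -/
theorem inReach_both_wall (hk : 2 ≤ k) {L : ℕ} (hL : 1 ≤ L) {r : ℝ} (hr : (a : ℝ) + 1 ≤ r) :
    InReach L r 1 (fun _ => 0) ((⟨2, by omega⟩, 0) : TW d k a) ∧
    InReach L r 1 (fun _ => 0) ((⟨0, Nat.succ_pos k⟩, cornerA d a) : TW d k a) := by
  have hLpos : (0 : ℝ) < L := by exact_mod_cast hL
  have hL0 : (L : ℝ) ≠ 0 := hLpos.ne'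
  have hL' : (1 : ℝ) ≤ L := by exact_mod_cast hL
  have ha : (0 : ℝ) ≤ a := Nat.cast_nonneg a
  have hr0 : 0 ≤ r := by linarith
  have h1 : off L a 1 = (a : ℤ) + 1 := by simp [off_succ, off_zero]
  constructor
  · intro μ
    unfold frame
    by_cases hμ : μ = 0
    · subst hμ
      have h2 : pos L ((⟨2, by omega⟩, 0) : TW d k a) 0 = ((a : ℤ) + 1) + ((a : ℤ) + 1) * (L : ℤ) := by
        simp [pos, lvl, off_succ, off_zero, zv]
      rw [if_pos rfl, h2, h1, pow_one, sub_zero]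
      have : ((((a : ℤ) + 1 + ((a : ℤ) + 1) * (L : ℤ) - ((a : ℤ) + 1)) : ℤ) : ℝ) / (L : ℝ) = (a : ℝ) + 1 := by
        push_cast; field_simp; ring
      rw [this, abs_of_nonneg (by positivity)]
      exact hr
    · have h2 : pos L ((⟨2, by omega⟩, 0) : TW d k a) μ = 0 := by simp [pos, lvl, zv, hμ]
      rw [if_neg hμ, h2]
      simpa using hr0
  · intro μ
    unfold frame
    by_cases hμ : μ = 0
    · subst hμ
      have h0 : pos L ((⟨0, Nat.succ_pos k⟩, cornerA d a) : TW d k a) 0 = (a : ℤ) := by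
        simp [pos, lvl, off_zero, zv, cornerA]
      rw [if_pos rfl, h0, h1, pow_one, sub_zero]
      have : ((((a : ℤ) - ((a : ℤ) + 1)) : ℤ) : ℝ) / (L : ℝ) = -(1 / (L : ℝ)) := by push_cast; ring
      rw [this, abs_neg, abs_of_nonneg (by positivity)]
      calc 1 / (L : ℝ) ≤ 1 := by rw [div_le_one hLpos]; exact hL'
        _ ≤ r := by linarith
    · have h0 : pos L ((⟨0, Nat.succ_pos k⟩, cornerA d a) : TW d k a) μ = 0 := by
        simp [pos, lvl, zv, cornerA, hμ]
      rw [if_neg hμ, h0]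
      simpa using hr0

/-- **Reading the thresholds in R, M, L** (the tower's (2.2) is RM ≤ a + 1, `…B6LevelTower.twGeo_levelSep`): for an
object of ρ big blocks half-width (r = ρM), R ≥ ρL gives the downward condition rL² < (a + 1)L + 1 … [folklore] -/
theorem reach_thr_of_R {L m : ℕ} (hL : 1 ≤ L) {R ρ : ℝ} (hRm : R * m ≤ (a : ℝ) + 1) (hR : ρ * L ≤ R) :
    ρ * m * (L : ℝ) ^ 2 < ((a : ℝ) + 1) * L + 1 := by
  have hm : (0 : ℝ) ≤ m := Nat.cast_nonneg m
  have hL' : (0 : ℝ) ≤ L := Nat.cast_nonneg L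
  have h1 : ρ * m * (L : ℝ) ^ 2 = (ρ * L) * (m * L) := by ring
  have h2 : (ρ * L) * (m * L) ≤ R * (m * L) := mul_le_mul_of_nonneg_right hR (by positivity)
  have h3 : R * (m * L) = (R * m) * L := by ring
  have h4 : (R * m) * L ≤ ((a : ℝ) + 1) * L := mul_le_mul_of_nonneg_right hRm hL'
  linarith

/-- … and R ≥ 2ρ gives the both-neighbours condition 2rL < (a + 1)L + 1. [folklore] -/
theorem both_thr_of_R {L m : ℕ} {R ρ : ℝ} (hRm : R * m ≤ (a : ℝ) + 1) (hR : 2 * ρ ≤ R) :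
    2 * (ρ * m) * L < ((a : ℝ) + 1) * L + 1 := by
  have hm : (0 : ℝ) ≤ m := Nat.cast_nonneg m
  have hL' : (0 : ℝ) ≤ L := Nat.cast_nonneg L
  have h2 : (2 * ρ) * (m * L) ≤ R * (m * L) := mul_le_mul_of_nonneg_right hR (by positivity)
  have h4 : (R * m) * L ≤ ((a : ℝ) + 1) * L := mul_le_mul_of_nonneg_right hRm hL'
  nlinarith

/-- **THE PRESUPPOSITION OF THE TWO-SCALE LOCAL ANALYSIS, on the tower, from R ≥ ρL and R ≥ 2ρ** (RM ≤ a + 1,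
L ≥ 1): every level-l object of ρ-blocks half-width centred in its box meets only levels l, l ± 1, and never both
l + 1 and l − 1 — the located objection G-B6-13 («R ≥ 4L», «R > 8» for T_□ = □̃³, ρ = 4) made kernel arithmetic.
[cite: Balaban1984PropagatorsII, (2.2) p.224 + p.230 + p.235 + p.238] -/
theorem two_scale_of_R {L m : ℕ} (hL : 1 ≤ L) {R ρ : ℝ} (hRm : R * m ≤ (a : ℝ) + 1) (hRL : ρ * L ≤ R)
    (hR2 : 2 * ρ ≤ R) :
    (∀ (l : ℕ) (c : Fin d → ℝ) (y : TW d k a), 0 ≤ c 0 → c 0 ≤ a → InReach L (ρ * m) l c y →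
        lvl y ≤ l + 1 ∧ l ≤ lvl y + 1) ∧
    (∀ (l : ℕ) (c : Fin d → ℝ) (y y' : TW d k a), lvl y = l + 1 → lvl y' + 1 = l →
        ¬ (InReach L (ρ * m) l c y ∧ InReach L (ρ * m) l c y')) :=
  ⟨fun _ _ _ hc0 hca h => inReach_two_scale hL hc0 hca (reach_thr_of_R hL hRm hRL) h,
    fun _ _ _ _ hy hy' => not_inReach_both hL (both_thr_of_R hRm hR2) hy hy'⟩

end Frames

/-! ## §6  Non-vacuity: three levels, the sums finite with an explicit constant, the thresholds attained -/

/-- **Instance** (d, k, a, M, L, η, R) = (1, 2, 5, 2, 2, 1, 3) — three levels, RM = 6 = a + 1: the profile and (2.61) ∕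
(2.63) hold with the explicit K_TW; an object of half-width r = 3 (rL² = 12 < 13 = (a+1)L + 1) is two-scale, while
r = 4 = 2M (= □̃ for M = 2; rL² = 16 ≥ 13) reaches from level 2 down to level 0, and r = 6 = a + 1 centred at the near
corner of level 1 meets levels 0, 1, 2: the thresholds are attained on the model. [cite: Balaban1984PropagatorsII, (2.61) p.234 + (2.2) p.224 + p.238] -/
theorem towerSums_nonvacuous :
    Profile (twGeo 1 2 5 2 2 1 3).dist (fun b => b) (Ktw 1 2) ∧
    Ineq261With (Ktw 1 2 ((1 / 2) * 1)) (twGeo 1 2 5 2 2 1 3) 1 (1 / 2) ∧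
    Ineq263With (Ktw 1 2 ((1 / 2) * 1)) (twGeo 1 2 5 2 2 1 3) 1 (1 / 2) ∧
    (∀ (l : ℕ) (c : Fin 1 → ℝ) (y : TW 1 2 5), 0 ≤ c 0 → c 0 ≤ 5 → InReach 2 3 l c y →
        lvl y ≤ l + 1 ∧ l ≤ lvl y + 1) ∧
    InReach 2 4 2 (fun _ => 0) ((⟨0, by norm_num⟩, cornerA 1 5) : TW 1 2 5) ∧
    (InReach 2 6 1 (fun _ => 0) ((⟨2, by norm_num⟩, 0) : TW 1 2 5) ∧
      InReach 2 6 1 (fun _ => 0) ((⟨0, by norm_num⟩, cornerA 1 5) : TW 1 2 5)) := by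
  refine ⟨twGeo_profile 1 2 5 2 2 1 3 (by norm_num), twGeo_ineq261With 1 2 5 2 2 1 3 (by norm_num) (by norm_num),
    twGeo_ineq263With 1 2 5 2 2 1 3 (by norm_num) (by norm_num) (by norm_num) (by norm_num),
    fun l c y hc0 hca h => inReach_two_scale (by norm_num) hc0 (by simpa using hca) (by norm_num) h,
    inReach_wall2 (by norm_num) (by norm_num),
    inReach_both_wall le_rfl (by norm_num) (by norm_num)⟩

/-- 16 ≤ e³ and 4e^{−24} ≤ 1 (the numerics of the located largeness conditions at L = 2, RM = 24). [folklore] -/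
theorem exp_three_ge_sixteen : (16 : ℝ) ≤ Real.exp 3 ∧ 4 * Real.exp (-24) ≤ 1 := by
  constructor
  · have h := Real.exp_one_gt_d9
    have h3 : Real.exp 3 = Real.exp 1 ^ 3 := by rw [← Real.exp_nat_mul]; norm_num
    rw [h3]
    calc (16 : ℝ) ≤ 2.7182818283 ^ 3 := by norm_num
      _ ≤ Real.exp 1 ^ 3 := pow_le_pow_left₀ (by norm_num) h.le 3
  · have h24 : (25 : ℝ) ≤ Real.exp 24 := by have := Real.add_one_le_exp (24 : ℝ); linarith
    have hpos : 0 < Real.exp 24 := Real.exp_pos _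
    rw [Real.exp_neg]
    rw [mul_inv_le_iff₀ hpos]
    linarith

/-- **Instance WITH the located largeness conditions** (d, k, a, M, L, η, R) = (1, 2, 23, 4, 2, 1, 6) — three levels,
RM = 24 = a + 1 — at the rates α′δ₀ = 1 (α′ = ¼, δ₀ = 4), δ = 4 (so (δ − α′δ₀)∕3 = 1), σ = ½, δ₁ = 1: every
geometry-side binder of `twGeo_prop23_geometry` AND the engine's two located conditions `hsize` (L²e^{−α′δ₀·RM} ≤ 1)
and `hthr` (L⁴ ≤ e^{⅛((δ−α′δ₀)∕3)RM}, here 16 ≤ e³) hold TOGETHER with `LevelSep` (RM ≤ a + 1) on ≥ 3 levels: (2.2)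
and «RM large against L» are compatible — jointly they only force the level thickness a + 1 ≥ RM ≥ 8·ln(L⁴)∕((δ−α′δ₀)∕3).
[cite: Balaban1984PropagatorsII, (2.2) p.224; (2.68) p.235 (e^{−⅙δ₀RM max{|j″−j|−1,0}} L^{2(j″−j)}); (2.83) p.237
(e^{−⅛δ₀RM max{|j−j′|−1,0}} L^{4(j−j′)}); p.238 («so for M large enough the norm is small»)] -/
theorem towerSums_largeness_nonvacuous :
    (IsPseudoDist (twGeo 1 2 23 4 2 1 6).dist ∧ LevelSep (twGeo 1 2 23 4 2 1 6) ∧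
      Ineq260 (twGeo 1 2 23 4 2 1 6) 4 (1 / 4) ∧
      (∀ b : ℝ, 0 < b → 0 ≤ Ktw 1 2 b) ∧ Profile (twGeo 1 2 23 4 2 1 6).dist (fun y => y) (Ktw 1 2) ∧
      Ineq261With (Ktw 1 2 (1 / 2 * ((4 - 1 / 4 * 4) / 3))) (twGeo 1 2 23 4 2 1 6) ((4 - 1 / 4 * 4) / 3) (1 / 2) ∧
      Ineq261With (Ktw 1 2 (1 / 2 * 1)) (twGeo 1 2 23 4 2 1 6) 1 (1 / 2) ∧
      Ineq263With (Ktw 1 2 (1 / 2 * 1)) (twGeo 1 2 23 4 2 1 6) 1 (1 / 2) ∧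
      0 ≤ Ktw 1 2 (1 / 2 * 1)) ∧
    (twGeo 1 2 23 4 2 1 6).L ^ 2 * Real.exp (-(1 / 4 * 4 * ((twGeo 1 2 23 4 2 1 6).R * (twGeo 1 2 23 4 2 1 6).M))) ≤ 1 ∧
    (twGeo 1 2 23 4 2 1 6).L ^ 4 ≤
      Real.exp (1 / 8 * ((4 - 1 / 4 * 4) / 3) * (twGeo 1 2 23 4 2 1 6).R * (twGeo 1 2 23 4 2 1 6).M) := by
  obtain ⟨h3, h24⟩ := exp_three_ge_sixteen
  refine ⟨twGeo_prop23_geometry 1 2 23 4 2 1 6 (by norm_num) (by norm_num) (by norm_num) (by norm_num) (by norm_num)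
    (by norm_num), ?_, ?_⟩
  · show ((2 : ℕ) : ℝ) ^ 2 * Real.exp (-(1 / 4 * 4 * (6 * ((4 : ℕ) : ℝ)))) ≤ 1
    norm_num
    exact h24
  · show ((2 : ℕ) : ℝ) ^ 4 ≤ Real.exp (1 / 8 * ((4 - 1 / 4 * 4) / 3) * 6 * ((4 : ℕ) : ℝ))
    norm_num
    exact h3

end Literature.MathematicalPhysics.QuantumFieldTheory.Balaban1983to89.B6TowerSums
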